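import Literature.MathematicalPhysics.StatisticalMechanics.Theil2006SimplexCover
import Literature.MathematicalPhysics.StatisticalMechanics.Theil2006ReferenceSurjectivity
import Literature.MathematicalPhysics.StatisticalMechanics.Theil2006ReferenceUniqueness
import Literature.MathematicalPhysics.StatisticalMechanics.Theil2006SimplexDeficitCount
import HarnessLib

/-!
# Theil 2006, the `L²`-rigidity of long simplices (p. 11 / Proposition 4.3 (52)) with the
factor `C λ`: an elementary proof from Lemma 4.2 and the telescoping of (61)

Topic `Literature/MathematicalPhysics/StatisticalMechanics`; companion of `Theil2006.lean`
(F. Theil, *A proof of crystallization in two dimensions*, Comm. Math. Phys. **262** (2006)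
209–236, accepted preprint of 26 Aug 2005, same numbering), §2.4 (p. 11) and Appendix §4.1
Lemma 4.2, Proposition 4.3 (pp. 17–18), §4.2 Proposition 4.8 (pp. 21, 23).

## Source, as printed

p. 11 (proof of Proposition 2.9, the term `I₂`; transcription `LIT1-AS-PRINTED.md` §32 of the
cell): for `T ∈ 𝒯_λ(y)`, «`Σ_{{x,x′} ⊂ T} (|y(x) − y(x′)| − λ)² ≤
C log(λ) Σ_{{x,x′} ∈ 𝒮, {x,x′} ⊂ ω_T} (|y(x) − y(x′)| − 1)²`» («the `L²`-rigidity estimate provided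
by Proposition 4.3 applied to `u(ξ) := y(Φ⁻¹(ξ))`»), `ω_T` the patch of Definition 2.6
(`y(ω_T) ⊂ B(z_T, 5λ)`).  Proposition 4.3 (p. 18): «Let `M ∈ ℕ ∖ {0,1}` and
`Ω = conv{(0,0), M(1,0), (M/2)(1,√3)} ⊂ ℝ²` be a dilated unit simplex. There exist a universal
constant `C > 0` such that for all `u : Ω ∩ A₂ → ℝ²` the estimate
(52) `min_{τ ∈ ℝ², R ∈ SO(2)} max_{x ∈ ∂Ω ∩ A₂} |u(x) − τ − Rx|² ≤
C log(M) Σ_{x,x′ ∈ Ω ∩ A₂, |x − x′| = 1} ||u(x) − u(x′)| − 1|²` holds.», proved from Lemma 4.2, the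
geometric-rigidity estimate (53) of Friesecke–James–Müller and the trace theorem (54)–(58).

## What this file proves, and how

`Theil2006.rigidityL2_of_existsRigid` — the p. 11 display with `C log λ` replaced by `C λ`
(a weaker per-`λ` factor, still summable against the weights `λ⁻⁷ · #𝒯_λ ∼ λ⁻⁷ · λ² m(λ)` of
(34)), for all `0 < α < α₂`, all finite configurations with (13), all `λ ∈ Λ ∖ {1}` and all
`T ∈ 𝒯_λ(y)` (the tree's centred `Theil2006.simplicesAt`), with `ω_T` = the particles within `5λ`
of the barycentre — in the exact shape of hypothesis (H52) of `Theil2006FromReferences` — from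
hypothesis (H48′), the existence of reference charts with (61) on defect-free discs
(`Theil2006_existsRigidReference`; only the existence of the chart is used).

The proof is NOT the print's ([FJM] is not available); it is the elementary `L²` version of the
telescoping argument by which §4.2 proves (61) (tree: `Theil2006ReferenceRigidity.lean`, whose
private machinery — Lemma 4.2 in bi-Lipschitz form with explicit constants, the affine
interpolations on unit simplices, the two telescoping chains — is re-developed here with each
simplex's OWN deviation `m_S = √(Σ_{bonds of S} (|y x − y x′| − 1)²)` in place of the uniform `α`):
for `x ≠ x′ ∈ T` with chart labels `λ` apart ((60), `discreteImbedding_unique_ball`, and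
Definition 2.6),
* y-side (`sub_dist_le_aux`): along `[y(x), y(x′)]`, covered by the closed unit simplices of `y`
  ((63), `Theil2006SimplexCover`), the interpolations `u_S` have gradients `≤ (1 − K m_S)⁻¹`, the
  segment spends parameter length `w_S ≤ (1 + α)/|y x − y x′|` in `S`, so
  `λ − |y x − y x′| ≤ |y x − y x′| · 2K Σ_S m_S w_S ≤ 2K √((1 + α)|y x − y x′| Σ_S m_S²)`
  (Cauchy–Schwarz, `Σ w_S = 1`);
* label side (`dist_sub_le_aux`): along `[Φ(x), Φ(x′)]`, through the unit triangles of `A₂`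
  realized by particles ((62), `Theil2006ReferenceSurjectivity`), gradients `≤ 1 + K m_S`,
  `w ≤ 1/λ`, so `|y x − y x′| − λ ≤ K √(λ Σ_S m_S²)`;
* hence `(|y x − y x′| − λ)² ≤ 8K² λ Σ_S m_S²`, the sum over the unit simplices of the chart disc
  `B(z_T, 5λ − ½)`, and `Σ_S m_S² ≤ 4 Σ_{{x,x′} ∈ 𝒮(y), ⊂ ω_T} (|y x − y x′| − 1)²` since a short
  bond lies in at most two unit simplices (`simplexCount_le_two`).
The factor `λ` (from `w ≤ 1/λ` over a segment of length `λ`) is where the print's `log λ`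
(capacity of an annulus) is lost.  Everything here is proved; the only definition is the
bookkeeping quantity `Theil2006.sqDev`; no named facts.
-/

noncomputable section

universe u

open scoped BigOperators
open Set Metric

namespace Literature.MathematicalPhysics.StatisticalMechanics

namespace Theil2006

section Chain

variable {E : Type*} [SeminormedAddCommGroup E] {ι : Type*}

/-- **Weighted telescoping along a finite closed cover of an interval.** If `[s, t]` is covered
by finitely many closed sets `C i`, `‖g v − g u‖ ≤ L_i |v − u|` whenever `u, v` lie in a common
`C i` (`L_i ≥ 0`), and each `C i ∩ [s, t]` has diameter `≤ M`, then
`‖g t − g s‖ ≤ Σ_i L_i w_i` for weights `0 ≤ w_i ≤ M` with `Σ_i w_i = t − s` (`w_i` = the length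
of the step spent in `C i`): with `b = max (C i ∩ [s, t])` for a member containing `s`, the
interval `[b, t]` is covered by the other members (closedness), and one inducts on their number.
[folklore] -/
private theorem exists_weights_of_cover_Icc (C : ι → Set ℝ) (g : ℝ → E) (L : ι → ℝ) (M : ℝ) :
    ∀ (𝒞 : Finset ι) (s t : ℝ), s ≤ t → 0 ≤ M → (∀ i ∈ 𝒞, IsClosed (C i)) → (∀ i ∈ 𝒞, 0 ≤ L i) →
      (∀ i ∈ 𝒞, ∀ u ∈ C i, ∀ v ∈ C i, ‖g v - g u‖ ≤ L i * |v - u|) →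
      (∀ i ∈ 𝒞, ∀ u ∈ C i ∩ Icc s t, ∀ v ∈ C i ∩ Icc s t, |v - u| ≤ M) →
      Icc s t ⊆ (⋃ i ∈ 𝒞, C i) →
      ∃ w : ι → ℝ, (∀ i, 0 ≤ w i ∧ w i ≤ M) ∧ ∑ i ∈ 𝒞, w i = t - s ∧
        ‖g t - g s‖ ≤ ∑ i ∈ 𝒞, L i * w i := by
  intro 𝒞
  classical
  induction 𝒞 using Finset.strongInduction with
  | H 𝒞 ih =>
    intro s t hst hM hcl hL hg hdiam hcov
    obtain ⟨i, hi, hsi⟩ : ∃ i ∈ 𝒞, s ∈ C i := by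
      simpa only [mem_iUnion, exists_prop] using hcov (left_mem_Icc.2 hst)
    set S : Set ℝ := C i ∩ Icc s t with hS
    have hSc : IsCompact S := isCompact_Icc.inter_left (hcl i hi)
    have hsS : s ∈ S := ⟨hsi, left_mem_Icc.2 hst⟩
    have hbdd : BddAbove S := hSc.bddAbove
    set b : ℝ := sSup S with hb
    have hbS : b ∈ S := hSc.sSup_mem ⟨s, hsS⟩
    have hsb : s ≤ b := le_csSup hbdd hsS
    have hbt : b ≤ t := hbS.2.2
    have h1 : ‖g b - g s‖ ≤ L i * (b - s) := by
      have := hg i hi s hsi b hbS.1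
      rwa [abs_of_nonneg (sub_nonneg.2 hsb)] at this
    have hbsM : b - s ≤ M := by
      have := hdiam i hi s hsS b hbS
      rwa [abs_of_nonneg (sub_nonneg.2 hsb)] at this
    rcases eq_or_lt_of_le hbt with hbt' | hblt
    · -- one step suffices
      refine ⟨fun j => if j = i then b - s else 0, fun j => ?_, ?_, ?_⟩
      · by_cases hj : j = i
        · simp only [hj, if_true]; exact ⟨sub_nonneg.2 hsb, hbsM⟩
        · simp only [hj, if_false]; exact ⟨le_rfl, hM⟩
      · rw [Finset.sum_ite_eq' 𝒞 i, if_pos hi, hbt']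
      · rw [← hbt']
        calc ‖g b - g s‖ ≤ L i * (b - s) := h1
          _ = ∑ j ∈ 𝒞, L j * (if j = i then b - s else 0) := by
              rw [show (fun j => L j * (if j = i then b - s else 0)) =
                  fun j => if j = i then L j * (b - s) else 0 from
                  funext fun j => by split_ifs <;> simp, Finset.sum_ite_eq' 𝒞 i, if_pos hi]
    -- `[b, t]` is covered by the other members
    have hcov' : Icc b t ⊆ ⋃ j ∈ 𝒞.erase i, C j := by
      intro u hu
      have key : ∀ u, b < u → u ≤ t → u ∈ ⋃ j ∈ 𝒞.erase i, C j := by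
        intro u hbu hut
        have hucov := hcov ⟨hsb.trans hbu.le, hut⟩
        simp only [mem_iUnion, exists_prop] at hucov
        obtain ⟨j, hj, huj⟩ := hucov
        have hji : j ≠ i := by
          rintro rfl
          have : u ≤ b := le_csSup hbdd ⟨huj, hsb.trans hbu.le, hut⟩
          linarith
        exact mem_iUnion₂.2 ⟨j, Finset.mem_erase.2 ⟨hji, hj⟩, huj⟩
      rcases eq_or_lt_of_le hu.1 with hbu | hbu
      · -- `u = b`: the complement of the finite union is open
        rw [← hbu]
        by_contra hnot
        have hclosedU : IsClosed (⋃ j ∈ 𝒞.erase i, C j) :=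
          isClosed_biUnion_finset fun j hj => hcl j (Finset.mem_of_mem_erase hj)
        obtain ⟨ε, hε, hεball⟩ := Metric.isOpen_iff.1 hclosedU.isOpen_compl b hnot
        set u' : ℝ := min (b + ε / 2) t with hu'
        have hu'1 : b < u' := lt_min (by linarith) hblt
        have hu'2 : u' ≤ t := min_le_right _ _
        have hu'3 : u' ∈ ball b ε := by
          rw [mem_ball, Real.dist_eq, abs_of_pos (by linarith)]
          have := min_le_left (b + ε / 2) t
          linarith
        exact hεball hu'3 (key u' hu'1 hu'2)
      · exact key u hbu hu.2
    obtain ⟨w', hw', hsum', h2⟩ := ih (𝒞.erase i) (Finset.erase_ssubset hi) b t hbt hM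
      (fun j hj => hcl j (Finset.mem_of_mem_erase hj))
      (fun j hj => hL j (Finset.mem_of_mem_erase hj))
      (fun j hj => hg j (Finset.mem_of_mem_erase hj))
      (fun j hj u hu v hv => hdiam j (Finset.mem_of_mem_erase hj) u
        ⟨hu.1, hsb.trans hu.2.1, hu.2.2⟩ v ⟨hv.1, hsb.trans hv.2.1, hv.2.2⟩) hcov'
    refine ⟨fun j => if j = i then b - s else w' j, fun j => ?_, ?_, ?_⟩
    · by_cases hj : j = i
      · simp only [hj, if_true]; exact ⟨sub_nonneg.2 hsb, hbsM⟩
      · simp only [hj, if_false]; exact hw' j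
    · show ∑ j ∈ 𝒞, (if j = i then b - s else w' j) = t - s
      rw [← Finset.add_sum_erase 𝒞 _ hi, if_pos rfl,
        Finset.sum_congr rfl fun j hj => if_neg (Finset.ne_of_mem_erase hj), hsum']
      ring
    · show ‖g t - g s‖ ≤ ∑ j ∈ 𝒞, L j * (if j = i then b - s else w' j)
      rw [← Finset.add_sum_erase 𝒞 _ hi, if_pos rfl,
        Finset.sum_congr rfl fun j hj => by rw [if_neg (Finset.ne_of_mem_erase hj)]]
      calc ‖g t - g s‖ = ‖(g t - g b) + (g b - g s)‖ := by rw [sub_add_sub_cancel]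
        _ ≤ ‖g t - g b‖ + ‖g b - g s‖ := norm_add_le _ _
        _ ≤ (∑ j ∈ 𝒞.erase i, L j * w' j) + L i * (b - s) := add_le_add h2 h1
        _ = L i * (b - s) + ∑ j ∈ 𝒞.erase i, L j * w' j := by ring

/-- **Cauchy–Schwarz for the weighted telescoping**: with `L_i = L₀ (1 + δ_i)`, `δ_i ≥ 0`,
`Σ w_i = ℓ`, `0 ≤ w_i ≤ M`, one has `Σ L_i w_i ≤ L₀ (ℓ + √(M ℓ Σ δ_i²))`, i.e.
`(Σ_i δ_i w_i)² ≤ M ℓ Σ_i δ_i²`. [folklore] -/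
private theorem sq_sum_mul_le {𝒞 : Finset ι} {δ w : ι → ℝ} {M ℓ : ℝ}
    (hw : ∀ i, 0 ≤ w i ∧ w i ≤ M) (hsum : ∑ i ∈ 𝒞, w i = ℓ) :
    (∑ i ∈ 𝒞, δ i * w i) ^ 2 ≤ M * ℓ * ∑ i ∈ 𝒞, δ i ^ 2 := by
  have hcs := Finset.sum_mul_sq_le_sq_mul_sq 𝒞 δ w
  have hw2 : ∑ i ∈ 𝒞, w i ^ 2 ≤ M * ℓ := by
    rw [← hsum, Finset.mul_sum]
    refine Finset.sum_le_sum fun i _ => ?_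
    rw [sq]
    exact mul_le_mul_of_nonneg_right (hw i).2 (hw i).1
  have h0 : 0 ≤ ∑ i ∈ 𝒞, δ i ^ 2 := Finset.sum_nonneg fun i _ => sq_nonneg _
  calc (∑ i ∈ 𝒞, δ i * w i) ^ 2 ≤ (∑ i ∈ 𝒞, δ i ^ 2) * ∑ i ∈ 𝒞, w i ^ 2 := hcs
    _ ≤ (∑ i ∈ 𝒞, δ i ^ 2) * (M * ℓ) := mul_le_mul_of_nonneg_left hw2 h0
    _ = M * ℓ * ∑ i ∈ 𝒞, δ i ^ 2 := by ring

end Chain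

/-! ### Plane algebra: `det₂`, Cramer's rule, the affine interpolation on a triangle -/

section Algebra

/-- `‖v‖² = v₀² + v₁²`. [folklore] -/
private theorem norm_sq_coords (v : Plane) : ‖v‖ ^ 2 = v 0 ^ 2 + v 1 ^ 2 := by
  rw [EuclideanSpace.norm_sq_eq, Fin.sum_univ_two, Real.norm_eq_abs, Real.norm_eq_abs, sq_abs,
    sq_abs]

/-- `det` is additive in the first slot. [folklore] -/
private theorem det₂_add_left (u v w : Plane) : det₂ (u + v) w = det₂ u w + det₂ v w := by
  unfold det₂
  simp only [PiLp.add_apply]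
  ring

/-- `det` is additive in the second slot. [folklore] -/
private theorem det₂_add_right (u v w : Plane) : det₂ u (v + w) = det₂ u v + det₂ u w := by
  unfold det₂
  simp only [PiLp.add_apply]
  ring

/-- `det` is homogeneous in the first slot. [folklore] -/
private theorem det₂_smul_left (c : ℝ) (u w : Plane) : det₂ (c • u) w = c * det₂ u w := by
  unfold det₂
  simp only [PiLp.smul_apply, smul_eq_mul]
  ring

/-- `det` is homogeneous in the second slot. [folklore] -/
private theorem det₂_smul_right (c : ℝ) (u w : Plane) : det₂ u (c • w) = c * det₂ u w := by
  unfold det₂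
  simp only [PiLp.smul_apply, smul_eq_mul]
  ring

/-- `det(u, u) = 0`. [folklore] -/
private theorem det₂_self (u : Plane) : det₂ u u = 0 := by
  unfold det₂; ring

/-- `det(u, s u + t v) = t det(u, v)`. [folklore] -/
private theorem det₂_smul_add_smul_right (u v : Plane) (s t : ℝ) :
    det₂ u (s • u + t • v) = t * det₂ u v := by
  rw [det₂_add_right, det₂_smul_right, det₂_smul_right, det₂_self]; ring

/-- `det(s u + t v, v) = s det(u, v)`. [folklore] -/
private theorem det₂_smul_add_smul_left (u v : Plane) (s t : ℝ) :
    det₂ (s • u + t • v) v = s * det₂ u v := by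
  rw [det₂_add_left, det₂_smul_left, det₂_smul_left, det₂_self]; ring

/-- Cramer's rule in the plane: `w = (det(w,v)/D) u + (det(u,w)/D) v`, `D = det(u,v) ≠ 0`.
[folklore] -/
private theorem cramer₂ (u v w : Plane) (hD : det₂ u v ≠ 0) :
    w = (det₂ w v / det₂ u v) • u + (det₂ u w / det₂ u v) • v := by
  have key : det₂ u v • w = det₂ w v • u + det₂ u w • v := by
    ext i
    fin_cases i
    · simp only [PiLp.add_apply, PiLp.smul_apply, smul_eq_mul, det₂, Fin.zero_eta, Fin.isValue]
      ring
    · simp only [PiLp.add_apply, PiLp.smul_apply, smul_eq_mul, det₂, Fin.mk_one, Fin.isValue]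
      ring
  calc w = (det₂ u v)⁻¹ • (det₂ u v • w) := by rw [smul_smul, inv_mul_cancel₀ hD, one_smul]
    _ = (det₂ w v / det₂ u v) • u + (det₂ u w / det₂ u v) • v := by
      rw [key, smul_add, smul_smul, smul_smul, div_eq_inv_mul, div_eq_inv_mul]

/-- **The linear part of the affine interpolation on a triangle.** For base points
`A₀, A₁, A₂` and values `B₀, B₁, B₂`, the linear map sending `A_i − A₀ ↦ B_i − B₀` (`i = 1, 2`),
written by Cramer's rule in the basis `(A₁ − A₀, A₂ − A₀)` (meaningful when
`det(A₁ − A₀, A₂ − A₀) ≠ 0`): the gradient `∇u` of the print's piecewise affine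
interpolation. [cite: Theil2006, §4.1 Lemma 4.2 («the gradient of the unique affine map u»,
preprint p. 17); §4.2 proof of (61) (p. 23)] -/
private def interpLin (A B : Fin 3 → Plane) : Plane →ₗ[ℝ] Plane where
  toFun w := (det₂ w (A 2 - A 0) / det₂ (A 1 - A 0) (A 2 - A 0)) • (B 1 - B 0) +
    (det₂ (A 1 - A 0) w / det₂ (A 1 - A 0) (A 2 - A 0)) • (B 2 - B 0)
  map_add' w w' := by
    simp only [det₂_add_left, det₂_add_right, add_div, add_smul]
    abel
  map_smul' c w := by
    simp only [det₂_smul_left, det₂_smul_right, RingHom.id_apply, smul_add, smul_smul,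
      mul_div_assoc]

/-- Unfolding the interpolation gradient. [folklore] -/
private theorem interpLin_apply (A B : Fin 3 → Plane) (w : Plane) :
    interpLin A B w = (det₂ w (A 2 - A 0) / det₂ (A 1 - A 0) (A 2 - A 0)) • (B 1 - B 0) +
      (det₂ (A 1 - A 0) w / det₂ (A 1 - A 0) (A 2 - A 0)) • (B 2 - B 0) := rfl

/-- The interpolation gradient on the first edge vector. [cite: Theil2006, §4.1 Lemma 4.2 (preprint p. 17)] -/
private theorem interpLin_base₁ (A B : Fin 3 → Plane) (hD : det₂ (A 1 - A 0) (A 2 - A 0) ≠ 0) :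
    interpLin A B (A 1 - A 0) = B 1 - B 0 := by
  rw [interpLin_apply, det₂_self, zero_div, zero_smul, add_zero, div_self hD, one_smul]

/-- The interpolation gradient on the second edge vector. [cite: Theil2006, §4.1 Lemma 4.2 (preprint p. 17)] -/
private theorem interpLin_base₂ (A B : Fin 3 → Plane) (hD : det₂ (A 1 - A 0) (A 2 - A 0) ≠ 0) :
    interpLin A B (A 2 - A 0) = B 2 - B 0 := by
  rw [interpLin_apply, det₂_self, zero_div, zero_smul, zero_add, div_self hD, one_smul]

/-- The interpolation gradient on every edge vector from `A₀`. [cite: Theil2006, §4.1 Lemma 4.2 (preprint p. 17)] -/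
private theorem interpLin_base (A B : Fin 3 → Plane) (hD : det₂ (A 1 - A 0) (A 2 - A 0) ≠ 0)
    (i : Fin 3) : interpLin A B (A i - A 0) = B i - B 0 := by
  fin_cases i
  · simp
  · exact interpLin_base₁ A B hD
  · exact interpLin_base₂ A B hD

/-- The interpolation gradient on every edge vector. [cite: Theil2006, §4.1 Lemma 4.2 (preprint p. 17)] -/
private theorem interpLin_sub (A B : Fin 3 → Plane) (hD : det₂ (A 1 - A 0) (A 2 - A 0) ≠ 0)
    (i j : Fin 3) : interpLin A B (A j - A i) = B j - B i := by
  have h : A j - A i = (A j - A 0) - (A i - A 0) := by abel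
  rw [h, map_sub, interpLin_base A B hD, interpLin_base A B hD]
  abel

/-- The two interpolation gradients of a pair of non-degenerate triangles are mutually inverse.
[cite: Theil2006, §4.1 Lemma 4.2 («F⁻¹», preprint p. 17)] -/
private theorem interpLin_interpLin (A B : Fin 3 → Plane) (hA : det₂ (A 1 - A 0) (A 2 - A 0) ≠ 0)
    (hB : det₂ (B 1 - B 0) (B 2 - B 0) ≠ 0) (w : Plane) :
    interpLin B A (interpLin A B w) = w := by
  set s := det₂ w (A 2 - A 0) / det₂ (A 1 - A 0) (A 2 - A 0) with hs
  set t := det₂ (A 1 - A 0) w / det₂ (A 1 - A 0) (A 2 - A 0) with ht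
  have h1 : interpLin A B w = s • (B 1 - B 0) + t • (B 2 - B 0) := rfl
  rw [h1, map_add, map_smul, map_smul, interpLin_base₁ B A hB, interpLin_base₂ B A hB]
  exact (cramer₂ _ _ w hA).symm

/-- **The affine interpolation** `u` with `u(A_i) = B_i`: `u(ξ) = B₀ + ∇u (ξ − A₀)`.
[cite: Theil2006, §4.2 proof of Proposition 4.8 (61) («the continuous and piecewise affine
interpolation», preprint p. 23)] -/
private def interp (A B : Fin 3 → Plane) (ξ : Plane) : Plane := B 0 + interpLin A B (ξ - A 0)

/-- The interpolation takes the prescribed values at the vertices. [cite: Theil2006, §4.2 proof of (61) (preprint p. 23)] -/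
private theorem interp_vertex (A B : Fin 3 → Plane) (hD : det₂ (A 1 - A 0) (A 2 - A 0) ≠ 0)
    (i : Fin 3) : interp A B (A i) = B i := by
  rw [interp, interpLin_base A B hD]; abel

/-- The interpolation is affine along every edge: `u(A_i + s(A_j − A_i)) = B_i + s(B_j − B_i)`.
[cite: Theil2006, §4.2 proof of (61) (preprint p. 23)] -/
private theorem interp_edge (A B : Fin 3 → Plane) (hD : det₂ (A 1 - A 0) (A 2 - A 0) ≠ 0)
    (i j : Fin 3) (s : ℝ) : interp A B (A i + s • (A j - A i)) = B i + s • (B j - B i) := by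
  rw [interp, show A i + s • (A j - A i) - A 0 = (A i - A 0) + s • (A j - A i) by abel, map_add,
    map_smul, interpLin_base A B hD, interpLin_sub A B hD]
  abel

/-- Differences of interpolated values are gradients of differences. [cite: Theil2006, §4.2 proof of (61) (preprint p. 23)] -/
private theorem interp_sub (A B : Fin 3 → Plane) (ξ ξ' : Plane) :
    interp A B ξ - interp A B ξ' = interpLin A B (ξ - ξ') := by
  unfold interp
  rw [add_sub_add_left_eq_sub, ← map_sub]
  congr 1
  abel

/-- An equilateral triangle of side `1` has `det² = 3/4` (Lagrange's identity). [folklore] -/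
private theorem det₂_sq_of_unit (P Q R : Plane) (hPQ : ‖Q - P‖ = 1) (hPR : ‖R - P‖ = 1)
    (hQR : ‖R - Q‖ = 1) : det₂ (Q - P) (R - P) ^ 2 = 3 / 4 := by
  have h1 := norm_sq_coords (Q - P)
  have h2 := norm_sq_coords (R - P)
  have h3 := norm_sq_coords (R - Q)
  rw [hPQ] at h1
  rw [hPR] at h2
  rw [hQR] at h3
  have e : R - Q = (R - P) - (Q - P) := by abel
  rw [e] at h3
  simp only [PiLp.sub_apply] at h1 h2 h3 ⊢
  unfold det₂
  simp only [PiLp.sub_apply]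
  nlinarith [h1, h2, h3]

end Algebra

/-! ### Lemma 4.2 per unit simplex of a discrete imbedding -/

section Triangle

/-- Lemma 4.2 in bi-Lipschitz form, as a predicate
on the two constants (so that the explicit-constant lemmas below can be stated before the
constants are chosen). [cite: Theil2006, §4.1 Lemma 4.2 (50)–(51) (preprint p. 17)] -/
private def SimplexBiLipschitz (K α₀ : ℝ) : Prop :=
  ∀ (y η : Fin 3 → Plane) (F : Plane →ₗ[ℝ] Plane),
    0 ≤ det₂ (y 1 - y 0) (y 2 - y 0) * det₂ (η 1 - η 0) (η 2 - η 0) →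
    (∀ i j : Fin 3, i ≠ j → ‖η i - η j‖ = 1) →
    (∀ i : Fin 3, F (η i - η 0) = y i - y 0) →
    ∀ m : ℝ, m ≤ α₀ → (∀ i j : Fin 3, i ≠ j → |‖y i - y j‖ - 1| ≤ m) →
      ∀ w : Plane, (1 - K * m) * ‖w‖ ≤ ‖F w‖ ∧ ‖F w‖ ≤ (1 + K * m) * ‖w‖

/-- The coordinate inner product on `ℝ²` (local copy). [folklore] -/
private def ipr (u v : Plane) : ℝ := u 0 * v 0 + u 1 * v 1

/-- `‖u − v‖² = ‖u‖² − 2⟨u,v⟩ + ‖v‖²`. [folklore] -/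
private theorem norm_sub_sq_ipr (u v : Plane) : ‖u - v‖ ^ 2 = ‖u‖ ^ 2 - 2 * ipr u v + ‖v‖ ^ 2 := by
  rw [norm_sq_coords, norm_sq_coords, norm_sq_coords, ipr]
  simp only [PiLp.sub_apply]
  ring

/-- `‖s u + t v‖² = s²‖u‖² + 2 s t ⟨u,v⟩ + t²‖v‖²`. [folklore] -/
private theorem norm_smul_add_smul_sq (s t : ℝ) (u v : Plane) :
    ‖s • u + t • v‖ ^ 2 = s ^ 2 * ‖u‖ ^ 2 + 2 * s * t * ipr u v + t ^ 2 * ‖v‖ ^ 2 := by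
  rw [norm_sq_coords, norm_sq_coords, norm_sq_coords, ipr]
  simp only [PiLp.add_apply, PiLp.smul_apply, smul_eq_mul]
  ring

/-- Lagrange's identity `⟨u,v⟩² + det(u,v)² = ‖u‖²‖v‖²`. [folklore] -/
private theorem ipr_sq_add_det₂_sq (u v : Plane) : ipr u v ^ 2 + det₂ u v ^ 2 = ‖u‖ ^ 2 * ‖v‖ ^ 2 := by
  rw [norm_sq_coords, norm_sq_coords, ipr, det₂]
  ring

/-- If `|a − 1| ≤ m ≤ 1` and `a ≥ 0` then `|a² − 1| ≤ 3m`. [folklore] -/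
private theorem sq_sub_one_bounds {a m : ℝ} (hm : m ≤ 1) (ha : 0 ≤ a) (h1 : -m ≤ a - 1)
    (h2 : a - 1 ≤ m) : -(3 * m) ≤ a ^ 2 - 1 ∧ a ^ 2 - 1 ≤ 3 * m := by
  have hm0 : 0 ≤ m := by linarith
  constructor <;> nlinarith

set_option maxHeartbeats 400000 in
/-- **Lemma 4.2, the bi-Lipschitz content, with explicit constants `K = 15`, `α₀ = 1`.** The
linear map taking an exact unit lattice triangle to a triangle with sides in `[1 − m, 1 + m]`
distorts lengths by at most the factor `1 ± 15m`: in the basis `e₁, e₂` of the unit triangle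
(`⟨e₁, e₂⟩ = ½`), `‖w‖² = s² + st + t²` for `w = s e₁ + t e₂`, while
`‖F w‖² = s²‖u‖² + 2st⟨u, v⟩ + t²‖v‖²` with `‖u‖², ‖v‖² ∈ [(1 − m)², (1 + m)²]` and
`2⟨u, v⟩ = ‖u‖² + ‖v‖² − ‖u − v‖² ∈ [1 − 9m, 1 + 9m]`. (The print's (50) gives closeness of
`∇u` to a rotation; only this consequence is used for (61).)
[cite: Theil2006, §4.1 Lemma 4.2 (50)–(51) (preprint p. 17); our constants] -/
private theorem exists_simplexBiLipschitz :
    ∃ K α₀ : ℝ, 0 < K ∧ 0 < α₀ ∧ SimplexBiLipschitz K α₀ := by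
  refine ⟨15, 1, by norm_num, by norm_num, fun y η F _ hη hF m hm hdef w => ?_⟩
  have hm0 : 0 ≤ m := (abs_nonneg _).trans (hdef 0 1 (by decide))
  -- the unit triangle `e₁ = η₁ − η₀`, `e₂ = η₂ − η₀`
  obtain ⟨e₁, he₁⟩ : ∃ e₁ : Plane, e₁ = η 1 - η 0 := ⟨_, rfl⟩
  obtain ⟨e₂, he₂⟩ : ∃ e₂ : Plane, e₂ = η 2 - η 0 := ⟨_, rfl⟩
  have hn1 : ‖e₁‖ = 1 := by rw [he₁]; exact hη 1 0 (by decide)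
  have hn2 : ‖e₂‖ = 1 := by rw [he₂]; exact hη 2 0 (by decide)
  have hn12 : ‖e₁ - e₂‖ = 1 := by
    rw [he₁, he₂, sub_sub_sub_cancel_right]; exact hη 1 2 (by decide)
  have hip : ipr e₁ e₂ = 1 / 2 := by
    have := norm_sub_sq_ipr e₁ e₂
    rw [hn1, hn2, hn12] at this
    linarith
  have hdet : det₂ e₁ e₂ ≠ 0 := by
    intro h0
    have := ipr_sq_add_det₂_sq e₁ e₂
    rw [hip, h0, hn1, hn2] at this
    norm_num at this
  -- coordinates of `w` in the basis `e₁, e₂`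
  obtain ⟨s, t, hw⟩ : ∃ s t : ℝ, w = s • e₁ + t • e₂ := ⟨_, _, cramer₂ e₁ e₂ w hdet⟩
  -- the image triangle `u = y₁ − y₀`, `v = y₂ − y₀`
  obtain ⟨u, hu⟩ : ∃ u : Plane, u = y 1 - y 0 := ⟨_, rfl⟩
  obtain ⟨v, hv⟩ : ∃ v : Plane, v = y 2 - y 0 := ⟨_, rfl⟩
  have hF1 : F e₁ = u := by rw [he₁, hu]; exact hF 1
  have hF2 : F e₂ = v := by rw [he₂, hv]; exact hF 2
  have hFw : F w = s • u + t • v := by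
    rw [hw, map_add, map_smul, map_smul, hF1, hF2]
  have hu1 := hdef 1 0 (by decide)
  have hv1 := hdef 2 0 (by decide)
  have huv1 := hdef 1 2 (by decide)
  have huv : y 1 - y 2 = u - v := by rw [hu, hv, sub_sub_sub_cancel_right]
  rw [huv] at huv1
  rw [← hu] at hu1
  rw [← hv] at hv1
  rw [abs_le] at hu1 hv1 huv1
  have hw2 : ‖w‖ ^ 2 = s ^ 2 + s * t + t ^ 2 := by
    rw [hw, norm_smul_add_smul_sq, hn1, hn2, hip]; ring
  have hF2' : ‖F w‖ ^ 2 = s ^ 2 * ‖u‖ ^ 2 + 2 * s * t * ipr u v + t ^ 2 * ‖v‖ ^ 2 := by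
    rw [hFw, norm_smul_add_smul_sq]
  have hipuv : 2 * ipr u v = ‖u‖ ^ 2 + ‖v‖ ^ 2 - ‖u - v‖ ^ 2 := by
    have := norm_sub_sq_ipr u v; linarith
  -- bounds on the squared side lengths
  have hu0 : 0 ≤ ‖u‖ := norm_nonneg _
  have hv0 : 0 ≤ ‖v‖ := norm_nonneg _
  have huv0 : 0 ≤ ‖u - v‖ := norm_nonneg _
  obtain ⟨hu1, hu1'⟩ := hu1
  obtain ⟨hv1, hv1'⟩ := hv1
  obtain ⟨huv1, huv1'⟩ := huv1
  have eu := sq_sub_one_bounds hm hu0 hu1 hu1'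
  have ev := sq_sub_one_bounds hm hv0 hv1 hv1'
  have euv := sq_sub_one_bounds hm huv0 huv1 huv1'
  have eip : -(9 * m) ≤ 2 * ipr u v - 1 ∧ 2 * ipr u v - 1 ≤ 9 * m := by
    rw [hipuv]; constructor <;> linarith [eu.1, eu.2, ev.1, ev.2, euv.1, euv.2]
  -- `|‖F w‖² − ‖w‖²| ≤ 15 m ‖w‖²`
  have hst : s ^ 2 + t ^ 2 ≤ 2 * ‖w‖ ^ 2 := by rw [hw2]; nlinarith [sq_nonneg (s + t)]
  have hst1 : s * t ≤ ‖w‖ ^ 2 := by rw [hw2]; nlinarith [sq_nonneg (s + t)]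
  have hst2 : -(s * t) ≤ ‖w‖ ^ 2 := by rw [hw2]; nlinarith [sq_nonneg (s - t)]
  have e : ‖F w‖ ^ 2 - ‖w‖ ^ 2 =
      s ^ 2 * (‖u‖ ^ 2 - 1) + t ^ 2 * (‖v‖ ^ 2 - 1) + s * t * (2 * ipr u v - 1) := by
    rw [hF2', hw2]; ring
  have h1 : s ^ 2 * (‖u‖ ^ 2 - 1) ≤ s ^ 2 * (3 * m) :=
    mul_le_mul_of_nonneg_left eu.2 (sq_nonneg s)
  have h1' : -(s ^ 2 * (3 * m)) ≤ s ^ 2 * (‖u‖ ^ 2 - 1) := by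
    have := mul_le_mul_of_nonneg_left eu.1 (sq_nonneg s); linarith
  have h2 : t ^ 2 * (‖v‖ ^ 2 - 1) ≤ t ^ 2 * (3 * m) :=
    mul_le_mul_of_nonneg_left ev.2 (sq_nonneg t)
  have h2' : -(t ^ 2 * (3 * m)) ≤ t ^ 2 * (‖v‖ ^ 2 - 1) := by
    have := mul_le_mul_of_nonneg_left ev.1 (sq_nonneg t); linarith
  have h3 : |s * t * (2 * ipr u v - 1)| ≤ ‖w‖ ^ 2 * (9 * m) := by
    rw [abs_mul]
    exact mul_le_mul (abs_le.2 ⟨by linarith, hst1⟩) (abs_le.2 ⟨by linarith, eip.2⟩)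
      (abs_nonneg _) (sq_nonneg _)
  rw [abs_le] at h3
  have hst3 : 3 * m * (s ^ 2 + t ^ 2) ≤ 3 * m * (2 * ‖w‖ ^ 2) :=
    mul_le_mul_of_nonneg_left hst (by positivity)
  have hup2 : ‖F w‖ ^ 2 ≤ (1 + 15 * m) * ‖w‖ ^ 2 := by linarith
  have hlo2 : (1 - 15 * m) * ‖w‖ ^ 2 ≤ ‖F w‖ ^ 2 := by linarith
  have hW0 : 0 ≤ ‖w‖ := norm_nonneg _
  have hFW0 : 0 ≤ ‖F w‖ := norm_nonneg _
  have hW2 : 0 ≤ ‖w‖ ^ 2 := sq_nonneg _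
  constructor
  · -- lower bound
    by_cases hneg : 1 - 15 * m ≤ 0
    · exact (mul_nonpos_of_nonpos_of_nonneg hneg hW0).trans hFW0
    · rw [not_le] at hneg
      have hsq : (1 - 15 * m) ^ 2 ≤ 1 - 15 * m := by
        rw [sq]; exact mul_le_of_le_one_right hneg.le (by linarith)
      have h2 : ((1 - 15 * m) * ‖w‖) ^ 2 ≤ ‖F w‖ ^ 2 := by
        rw [mul_pow]
        exact (mul_le_mul_of_nonneg_right hsq hW2).trans hlo2
      have h0 : 0 ≤ (1 - 15 * m) * ‖w‖ := mul_nonneg hneg.le hW0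
      exact (pow_le_pow_iff_left₀ h0 hFW0 two_ne_zero).1 h2
  · -- upper bound
    have h15 : 0 ≤ 1 + 15 * m := by linarith
    have hsq : 1 + 15 * m ≤ (1 + 15 * m) ^ 2 := by
      rw [sq]; exact le_mul_of_one_le_right h15 (by linarith)
    have h2 : ‖F w‖ ^ 2 ≤ ((1 + 15 * m) * ‖w‖) ^ 2 := by
      rw [mul_pow]
      exact hup2.trans (mul_le_mul_of_nonneg_right hsq hW2)
    exact (pow_le_pow_iff_left₀ hFW0 (mul_nonneg h15 hW0) two_ne_zero).1 h2

variable {X : Type*} {α : ℝ} {y : X → Plane} {ω : Set X} {Φ : X → ℤ × ℤ}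

/-- The positions of an ordered triple of particles. [cite: Theil2006, §4.1 Lemma 4.2 («y_i», preprint p. 17)] -/
private def yTri (y : X → Plane) (a b c : X) : Fin 3 → Plane := ![y a, y b, y c]

/-- The labels of an ordered triple of particles, as points of `A₂`. [cite: Theil2006, §4.1 Lemma 4.2 («η_i», preprint p. 17)] -/
private def ηTri (Φ : X → ℤ × ℤ) (a b c : X) : Fin 3 → Plane :=
  ![triPoint (Φ a), triPoint (Φ b), triPoint (Φ c)]

/-- First enumerated position. [folklore] -/
private theorem yTri_zero (a b c : X) : yTri y a b c 0 = y a := rfl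

/-- Second enumerated position. [folklore] -/
private theorem yTri_one (a b c : X) : yTri y a b c 1 = y b := rfl

/-- Third enumerated position. [folklore] -/
private theorem yTri_two (a b c : X) : yTri y a b c 2 = y c := rfl

/-- First enumerated label. [folklore] -/
private theorem ηTri_zero (a b c : X) : ηTri Φ a b c 0 = triPoint (Φ a) := rfl

/-- Second enumerated label. [folklore] -/
private theorem ηTri_one (a b c : X) : ηTri Φ a b c 1 = triPoint (Φ b) := rfl

/-- Third enumerated label. [folklore] -/
private theorem ηTri_two (a b c : X) : ηTri Φ a b c 2 = triPoint (Φ c) := rfl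

/-- Each vertex of `{a, b, c}` is one of the three enumerated ones. [folklore] -/
private theorem exists_index_of_mem [DecidableEq X] {a b c v : X}
    (hv : v ∈ ({a, b, c} : Finset X)) :
    ∃ i : Fin 3, y v = yTri y a b c i ∧ triPoint (Φ v) = ηTri Φ a b c i := by
  simp only [Finset.mem_insert, Finset.mem_singleton] at hv
  rcases hv with rfl | rfl | rfl
  · exact ⟨0, rfl, rfl⟩
  · exact ⟨1, rfl, rfl⟩
  · exact ⟨2, rfl, rfl⟩

/-- A symmetric relation holding on the three pairs `(0,1), (0,2), (1,2)` holds on all pairs of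
distinct indices of `Fin 3`. [folklore] -/
private theorem fin3_pairwise {β : Type*} (P : Fin 3 → β) {R : β → β → Prop}
    (hsymm : ∀ u v, R u v → R v u) (h01 : R (P 0) (P 1)) (h02 : R (P 0) (P 2))
    (h12 : R (P 1) (P 2)) : ∀ i j : Fin 3, i ≠ j → R (P i) (P j) := by
  intro i j hij
  fin_cases i <;> fin_cases j
  · exact absurd rfl hij
  · exact h01
  · exact h02
  · exact hsymm _ _ h01
  · exact absurd rfl hij
  · exact h12
  · exact hsymm _ _ h02
  · exact hsymm _ _ h12
  · exact absurd rfl hij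

/-- An `𝒮`-triangle is non-degenerate (`det² ≥ (21/25)²`, `Theil2006SimplexCover`).
[cite: Theil2006, §2.3 before Definition 2.4 (preprint p. 7); our constant] -/
private theorem det₂_yTri_ne_zero (hα : 0 < α) (hα' : α ≤ 1 / 200) {a b c : X}
    (hab : IsShortRange α y a b) (hac : IsShortRange α y a c) (hbc : IsShortRange α y b c) :
    det₂ (yTri y a b c 1 - yTri y a b c 0) (yTri y a b c 2 - yTri y a b c 0) ≠ 0 := by
  intro h0
  have h := sq_le_det₂_sq_of_isShortRange hα hα' hab hac hbc
  rw [yTri_zero, yTri_one, yTri_two] at h0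
  rw [h0] at h
  norm_num at h

/-- The labels of an `𝒮`-triangle inside the patch of a discrete imbedding form a unit lattice
triangle (Remark 2.5). [cite: Theil2006, §2.3 Remark 2.5 (preprint p. 7)] -/
private theorem norm_ηTri_sub (hΦ : IsDiscreteImbeddingOn α y ω Φ) (hα1 : α < 1) {a b c : X}
    (ha : a ∈ ω) (hb : b ∈ ω) (hc : c ∈ ω)
    (hab : IsShortRange α y a b) (hac : IsShortRange α y a c) (hbc : IsShortRange α y b c) :
    ∀ i j : Fin 3, i ≠ j → ‖ηTri Φ a b c i - ηTri Φ a b c j‖ = 1 := by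
  have dab := hΦ.dist_eq_one hα1 ha hb hab
  have dac := hΦ.dist_eq_one hα1 ha hc hac
  have dbc := hΦ.dist_eq_one hα1 hb hc hbc
  rw [dist_eq_norm] at dab dac dbc
  exact fin3_pairwise (ηTri Φ a b c) (R := fun u v => ‖u - v‖ = 1)
    (fun u v h => by rwa [norm_sub_rev]) dab dac dbc

/-- … hence are non-degenerate: `det² = 3/4`. [cite: Theil2006, §2.3 Remark 2.5 (preprint p. 7)] -/
private theorem det₂_ηTri_ne_zero (hΦ : IsDiscreteImbeddingOn α y ω Φ) (hα1 : α < 1) {a b c : X}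
    (ha : a ∈ ω) (hb : b ∈ ω) (hc : c ∈ ω)
    (hab : IsShortRange α y a b) (hac : IsShortRange α y a c) (hbc : IsShortRange α y b c) :
    det₂ (ηTri Φ a b c 1 - ηTri Φ a b c 0) (ηTri Φ a b c 2 - ηTri Φ a b c 0) ≠ 0 := by
  have h := norm_ηTri_sub hΦ hα1 ha hb hc hab hac hbc
  intro h0
  have h34 := det₂_sq_of_unit (ηTri Φ a b c 0) (ηTri Φ a b c 1) (ηTri Φ a b c 2)
    (h 1 0 (by decide)) (h 2 0 (by decide)) (h 2 1 (by decide))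
  rw [h0] at h34
  norm_num at h34

/-- **The squared bond deviation of a finite set of particles**: `Σ_{(x,x′) ∈ T², x ≠ x′}
(|y(x) − y(x′)| − 1)²` (ordered pairs, so each bond counted twice) — the quantity through which the
right-hand side `Σ_{{x,x′} ∈ 𝒮, {x,x′} ⊂ ω_T} (|y(x) − y(x′)| − 1)²` of the display of p. 11 /
Proposition 4.3 (52) enters. [cite: Theil2006, §2.4 display after (33) and Appendix Proposition 4.3
(52) (preprint pp. 11, 18)] -/
def sqDev (y : X → Plane) (T : Finset X) : ℝ :=
  ∑ p ∈ T.offDiag, (dist (y p.1) (y p.2) - 1) ^ 2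

/-- `sqDev ≥ 0`. [folklore] -/
private theorem sqDev_nonneg (T : Finset X) : 0 ≤ sqDev y T :=
  Finset.sum_nonneg fun _ _ => sq_nonneg _

/-- Each bond deficit of `T` is at most `√(sqDev T)`. [folklore] -/
private theorem abs_sub_one_le_sqrt_sqDev {T : Finset X} {a b : X} (ha : a ∈ T)
    (hb : b ∈ T) (hab : a ≠ b) : |dist (y a) (y b) - 1| ≤ Real.sqrt (sqDev y T) := by
  apply Real.abs_le_sqrt
  have hmem : (a, b) ∈ T.offDiag := Finset.mem_offDiag.2 ⟨ha, hb, hab⟩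
  have hnn : ∀ p ∈ T.offDiag, (0 : ℝ) ≤ (dist (y p.1) (y p.2) - 1) ^ 2 := fun p _ => sq_nonneg _
  have := Finset.sum_le_sum_of_subset_of_nonneg (Finset.singleton_subset_iff.2 hmem)
    (fun p hp _ => hnn p hp)
  rw [Finset.sum_singleton] at this
  exact this

/-- For a unit simplex (`#T = 3`, deficits `≤ α`), `sqDev T ≤ 6 α²`, so `√(sqDev T) ≤ 5α/2`.
[folklore] -/
private theorem sqrt_sqDev_le [DecidableEq X] (hα : 0 ≤ α) {T : Finset X} (h3 : T.card = 3)
    (hsr : ∀ x ∈ T, ∀ x' ∈ T, x ≠ x' → IsShortRange α y x x') :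
    Real.sqrt (sqDev y T) ≤ 5 / 2 * α := by
  have hle : sqDev y T ≤ 6 * α ^ 2 := by
    unfold sqDev
    have hcard : T.offDiag.card = 6 := by rw [Finset.offDiag_card, h3]
    have hb : ∀ p ∈ T.offDiag, (dist (y p.1) (y p.2) - 1) ^ 2 ≤ α ^ 2 := by
      intro p hp
      obtain ⟨h1, h2, h12⟩ := Finset.mem_offDiag.1 hp
      have h : |dist (y p.1) (y p.2) - 1| ≤ α := hsr _ h1 _ h2 h12
      rw [← sq_abs]
      exact pow_le_pow_left₀ (abs_nonneg _) h 2
    calc ∑ p ∈ T.offDiag, (dist (y p.1) (y p.2) - 1) ^ 2 ≤ ∑ _p ∈ T.offDiag, α ^ 2 :=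
          Finset.sum_le_sum hb
      _ = 6 * α ^ 2 := by rw [Finset.sum_const, hcard, nsmul_eq_mul]; norm_num
  calc Real.sqrt (sqDev y T) ≤ Real.sqrt (6 * α ^ 2) := Real.sqrt_le_sqrt hle
    _ ≤ 5 / 2 * α := by
        rw [Real.sqrt_le_left (by positivity)]
        nlinarith

/-- The bond-length deficits of an `𝒮`-triangle are `≤ √(sqDev)` (enumerated form). [folklore] -/
private theorem deficit_yTri_le [DecidableEq X] {a b c : X} (hab : a ≠ b) (hac : a ≠ c) (hbc : b ≠ c) :
    ∀ i j : Fin 3, i ≠ j →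
      |‖yTri y a b c i - yTri y a b c j‖ - 1| ≤ Real.sqrt (sqDev y ({a, b, c} : Finset X)) := by
  have ha : a ∈ ({a, b, c} : Finset X) := by simp
  have hb : b ∈ ({a, b, c} : Finset X) := by simp
  have hc : c ∈ ({a, b, c} : Finset X) := by simp
  have dab := abs_sub_one_le_sqrt_sqDev (y := y) ha hb hab
  have dac := abs_sub_one_le_sqrt_sqDev (y := y) ha hc hac
  have dbc := abs_sub_one_le_sqrt_sqDev (y := y) hb hc hbc
  rw [dist_eq_norm] at dab dac dbc
  exact fin3_pairwise (yTri y a b c)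
    (R := fun u v => |‖u - v‖ - 1| ≤ Real.sqrt (sqDev y ({a, b, c} : Finset X)))
    (fun u v h => by rwa [norm_sub_rev]) dab dac dbc

/-- **Lemma 4.2 for a unit simplex of a discrete imbedding, label-to-position direction, with the
simplex's own deviation**: the affine gradient `F_T` (`F_T(Φ(v) − Φ(v′)) = y(v) − y(v′)`) is
`(1 ± K m_T)`-bi-Lipschitz, `m_T = √(sqDev T)`. [cite: Theil2006, §4.1 Lemma 4.2 (50)
(preprint p. 17)] -/
private theorem triangle_bilipschitz_dev [DecidableEq X] {K α₀ : ℝ} (hBL : SimplexBiLipschitz K α₀)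
    (hΦ : IsDiscreteImbeddingOn α y ω Φ) (hα1 : α < 1) {a b c : X}
    (hab' : a ≠ b) (hac' : a ≠ c) (hbc' : b ≠ c)
    (hm : Real.sqrt (sqDev y ({a, b, c} : Finset X)) ≤ α₀)
    (ha : a ∈ ω) (hb : b ∈ ω) (hc : c ∈ ω)
    (hab : IsShortRange α y a b) (hac : IsShortRange α y a c) (hbc : IsShortRange α y b c)
    (w : Plane) :
    (1 - K * Real.sqrt (sqDev y ({a, b, c} : Finset X))) * ‖w‖ ≤
        ‖interpLin (ηTri Φ a b c) (yTri y a b c) w‖ ∧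
      ‖interpLin (ηTri Φ a b c) (yTri y a b c) w‖ ≤
        (1 + K * Real.sqrt (sqDev y ({a, b, c} : Finset X))) * ‖w‖ := by
  refine hBL (yTri y a b c) (ηTri Φ a b c) _ ?_ (norm_ηTri_sub hΦ hα1 ha hb hc hab hac hbc)
    (interpLin_base _ _ (det₂_ηTri_ne_zero hΦ hα1 ha hb hc hab hac hbc)) _ hm
    (deficit_yTri_le hab' hac' hbc') w
  simp only [yTri_zero, yTri_one, yTri_two, ηTri_zero, ηTri_one, ηTri_two]
  exact hΦ.orientationOn ha hb hc hab hac hbc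

/-- **Lemma 4.2, position-to-label direction, with the simplex's own deviation**:
`(1 − K m_T)|G_T v| ≤ |v|`. [cite: Theil2006, §4.1 Lemma 4.2 (51) (preprint p. 17)] -/
private theorem triangle_inv_lipschitz_dev [DecidableEq X] {K α₀ : ℝ} (hBL : SimplexBiLipschitz K α₀)
    (hΦ : IsDiscreteImbeddingOn α y ω Φ) (hα : 0 < α) (hα' : α ≤ 1 / 200) {a b c : X}
    (hab' : a ≠ b) (hac' : a ≠ c) (hbc' : b ≠ c)
    (hm : Real.sqrt (sqDev y ({a, b, c} : Finset X)) ≤ α₀)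
    (ha : a ∈ ω) (hb : b ∈ ω) (hc : c ∈ ω)
    (hab : IsShortRange α y a b) (hac : IsShortRange α y a c) (hbc : IsShortRange α y b c)
    (v : Plane) :
    (1 - K * Real.sqrt (sqDev y ({a, b, c} : Finset X))) *
        ‖interpLin (yTri y a b c) (ηTri Φ a b c) v‖ ≤ ‖v‖ := by
  have hα1 : α < 1 := by linarith
  have h := (triangle_bilipschitz_dev hBL hΦ hα1 hab' hac' hbc' hm ha hb hc hab hac hbc
    (interpLin (yTri y a b c) (ηTri Φ a b c) v)).1
  rwa [interpLin_interpLin _ _ (det₂_yTri_ne_zero hα hα' hab hac hbc)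
    (det₂_ηTri_ne_zero hΦ hα1 ha hb hc hab hac hbc)] at h

end Triangle

/-! ### The upper bound: telescoping along `[y(x), y(x′)]` through the unit simplices (63) -/

section Upper

variable {X : Type*} {α : ℝ} {y : X → Plane} {ω : Set X} {Φ : X → ℤ × ℤ}

/-- `y({a, b, c}) = {y(a), y(b), y(c)}`. [folklore] -/
private theorem image_coe_triple [DecidableEq X] (f : X → Plane) (a b c : X) :
    f '' ↑({a, b, c} : Finset X) = {f a, f b, f c} := by
  rw [Finset.coe_insert, Finset.coe_insert, Finset.coe_singleton, image_insert_eq,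
    image_insert_eq, image_singleton]

/-- **The upper deviation, `L²` form** (y-side telescoping): for a discrete imbedding near
`B(c, R)` (local patches around every unit simplex with vertices in `B(c, R)`), no defect in
`B(c, R)`, `r + 2 ≤ R`, and `y(x), y(x′) ∈ B(c, r)`:
`|Φ(x) − Φ(x′)| − |y(x) − y(x′)| ≤ 2K √((1 + α) |y(x) − y(x′)| Σ_T sqDev(T))`, the sum over the
unit simplices `T` with vertices in `B(c, R)`.  Proof: the affine interpolations `u_T` along the
segment `[y(x), y(x′)]` through the closed triangles of (63) have gradients
`|G_T| ≤ (1 − K m_T)⁻¹ ≤ 1 + 2K m_T` (Lemma 4.2 with the simplex's own deviation `m_T = √sqDev(T)`),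
agree on common faces, and the weighted telescoping plus Cauchy–Schwarz give the bound.
[cite: Theil2006, §4.1 Lemma 4.2, §4.2 (63) and Proposition 4.3 (52) (preprint pp. 17–18, 21);
our lemma] -/
private theorem sub_dist_le_aux [Fintype X] {K α₀ : ℝ} (hBL : SimplexBiLipschitz K α₀)
    (hK : 0 ≤ K) (hα : 0 < α) (hα' : α ≤ 1 / 200) (hαα₀ : 5 / 2 * α ≤ α₀)
    (hKα : K * α ≤ 1 / 10) (hsep : ∀ x x' : X, x ≠ x' → 1 - α < dist (y x) (y x'))
    {c : Plane} {r R : ℝ} (hrR : r + 2 ≤ R) (hdef : ∀ b ∈ defectSet α y, R ≤ dist (y b) c)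
    (hloc : ∀ ⦃a b c' : X⦄, y a ∈ ball c R → y b ∈ ball c R → y c' ∈ ball c R →
      IsShortRange α y a b → IsShortRange α y a c' → IsShortRange α y b c' →
      ∃ ω' : Set X, IsDiscreteImbeddingOn α y ω' Φ ∧ a ∈ ω' ∧ b ∈ ω' ∧ c' ∈ ω')
    {x x' : X} (hx : y x ∈ ball c r) (hx' : y x' ∈ ball c r) (𝒰 : Finset (Finset X))
    (h𝒰 : ∀ T : Finset X, IsEquilateralSimplex α y 1 T → (∀ z ∈ T, y z ∈ ball c R) → T ∈ 𝒰) :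
    dist (triPoint (Φ x)) (triPoint (Φ x')) - dist (y x) (y x') ≤
      2 * K * Real.sqrt ((1 + α) * dist (y x) (y x') * ∑ T ∈ 𝒰, sqDev y T) := by
  classical
  have hα1 : α < 1 := by linarith
  -- the cover triangles
  set 𝒯 : Finset (Finset X) :=
    Finset.univ.filter (fun T => IsEquilateralSimplex α y 1 T ∧ ∀ z ∈ T, y z ∈ ball c R) with h𝒯
  have hmem𝒯 : ∀ {T : Finset X}, T ∈ 𝒯 ↔ IsEquilateralSimplex α y 1 T ∧ ∀ z ∈ T, y z ∈ ball c R := by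
    intro T
    simp only [h𝒯, Finset.mem_filter, Finset.mem_univ, true_and]
  have hcov : ∀ ξ ∈ ball c r, ∃ T ∈ 𝒯, ξ ∈ convexHull ℝ (y '' ↑T) := fun ξ hξ => by
    obtain ⟨T, hT, hTR, hξT⟩ :=
      exists_simplex_mem_convexHull_of_mem_ball hα hα' hsep hrR hdef hx hξ
    exact ⟨T, hmem𝒯.2 ⟨hT, hTR⟩, hξT⟩
  have hTball : ∀ T ∈ 𝒯, ∀ z ∈ T, y z ∈ ball c R := fun T hT z hz => (hmem𝒯.1 hT).2 z hz
  have hTgood : ∀ T ∈ 𝒯, ∀ z ∈ T, z ∉ defectSet α y := fun T hT z hz hzd => by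
    have h1 := hdef z hzd
    have h2 := mem_ball.1 ((hmem𝒯.1 hT).2 z hz)
    linarith
  have hTsr : ∀ T ∈ 𝒯, ∀ p ∈ T, ∀ q ∈ T, p ≠ q → IsShortRange α y p q := fun T hT =>
    (isEquilateralSimplex_one_iff.1 (hmem𝒯.1 hT).1).2
  -- enumerations of the triangles
  have henum : ∀ T ∈ 𝒯, ∃ a b c' : X, a ≠ b ∧ a ≠ c' ∧ b ≠ c' ∧ T = {a, b, c'} := fun T hT =>
    Finset.card_eq_three.1 (hmem𝒯.1 hT).1.card_eq_three
  haveI : Nonempty X := ⟨x⟩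
  choose! va vb vc hab hac hbc hTeq using henum
  have hva : ∀ T ∈ 𝒯, va T ∈ T := fun T hT => by
    have h : va T ∈ ({va T, vb T, vc T} : Finset X) := by simp
    rwa [← hTeq T hT] at h
  have hvb : ∀ T ∈ 𝒯, vb T ∈ T := fun T hT => by
    have h : vb T ∈ ({va T, vb T, vc T} : Finset X) := by simp
    rwa [← hTeq T hT] at h
  have hvc : ∀ T ∈ 𝒯, vc T ∈ T := fun T hT => by
    have h : vc T ∈ ({va T, vb T, vc T} : Finset X) := by simp
    rwa [← hTeq T hT] at h
  have sab : ∀ T ∈ 𝒯, IsShortRange α y (va T) (vb T) := fun T hT =>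
    hTsr T hT _ (hva T hT) _ (hvb T hT) (hab T hT)
  have sac : ∀ T ∈ 𝒯, IsShortRange α y (va T) (vc T) := fun T hT =>
    hTsr T hT _ (hva T hT) _ (hvc T hT) (hac T hT)
  have sbc : ∀ T ∈ 𝒯, IsShortRange α y (vb T) (vc T) := fun T hT =>
    hTsr T hT _ (hvb T hT) _ (hvc T hT) (hbc T hT)
  -- the interpolations
  set uT : Finset X → Plane → Plane := fun T ξ =>
    interp (yTri y (va T) (vb T) (vc T)) (ηTri Φ (va T) (vb T) (vc T)) ξ with huT
  have hDy : ∀ T ∈ 𝒯, det₂ (yTri y (va T) (vb T) (vc T) 1 - yTri y (va T) (vb T) (vc T) 0)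
      (yTri y (va T) (vb T) (vc T) 2 - yTri y (va T) (vb T) (vc T) 0) ≠ 0 := fun T hT =>
    det₂_yTri_ne_zero hα hα' (sab T hT) (sac T hT) (sbc T hT)
  have hvert : ∀ T ∈ 𝒯, ∀ v ∈ T, uT T (y v) = triPoint (Φ v) := by
    intro T hT v hv
    rw [hTeq T hT] at hv
    obtain ⟨i, hyi, hηi⟩ := exists_index_of_mem (y := y) (Φ := Φ) hv
    simp only [huT]
    rw [hyi, interp_vertex _ _ (hDy T hT), hηi]
  have hedge : ∀ T ∈ 𝒯, ∀ p ∈ T, ∀ q ∈ T, ∀ s : ℝ,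
      uT T (y p + s • (y q - y p)) = triPoint (Φ p) + s • (triPoint (Φ q) - triPoint (Φ p)) := by
    intro T hT p hp q hq s
    rw [hTeq T hT] at hp hq
    obtain ⟨i, hyi, hηi⟩ := exists_index_of_mem (y := y) (Φ := Φ) hp
    obtain ⟨j, hyj, hηj⟩ := exists_index_of_mem (y := y) (Φ := Φ) hq
    simp only [huT]
    rw [hyi, hyj, interp_edge _ _ (hDy T hT), hηi, hηj]
  -- the interpolations agree on overlaps
  have huu : ∀ T ∈ 𝒯, ∀ T' ∈ 𝒯, ∀ ξ : Plane, ξ ∈ convexHull ℝ (y '' ↑T) →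
      ξ ∈ convexHull ℝ (y '' ↑T') → uT T ξ = uT T' ξ := by
    intro T hT T' hT' ξ hξ hξ'
    by_cases hTT' : T = T'
    · rw [hTT']
    have hface := convexHull_inter_convexHull_subset_face hα hα' hsep (hmem𝒯.1 hT).1
      (hmem𝒯.1 hT').1 hTT' (hTgood T hT) (hTgood T' hT') ⟨hξ, hξ'⟩
    have hlt : (T ∩ T').card < 3 := by
      rw [← (hmem𝒯.1 hT).1.card_eq_three]
      refine Finset.card_lt_card (Finset.ssubset_iff_subset_ne.2 ⟨Finset.inter_subset_left, ?_⟩)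
      intro heq
      apply hTT'
      have hsub : T ⊆ T' := by rw [← heq]; exact Finset.inter_subset_right
      exact Finset.eq_of_subset_of_card_le hsub
        (by rw [(hmem𝒯.1 hT).1.card_eq_three, (hmem𝒯.1 hT').1.card_eq_three])
    obtain h0 | h1 | h2 : (T ∩ T').card = 0 ∨ (T ∩ T').card = 1 ∨ (T ∩ T').card = 2 := by
      omega
    · rw [Finset.card_eq_zero] at h0
      rw [h0, Finset.coe_empty, image_empty, convexHull_empty] at hface
      exact absurd hface (notMem_empty _)
    · obtain ⟨v, hv⟩ := Finset.card_eq_one.1 h1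
      have hvT : v ∈ T ∩ T' := by rw [hv]; exact Finset.mem_singleton_self v
      rw [hv, Finset.coe_singleton, image_singleton, convexHull_singleton, mem_singleton_iff]
        at hface
      rw [hface, hvert T hT v (Finset.mem_inter.1 hvT).1, hvert T' hT' v (Finset.mem_inter.1 hvT).2]
    · obtain ⟨p, q, hpq, hpq'⟩ := Finset.card_eq_two.1 h2
      have hpT : p ∈ T ∩ T' := by rw [hpq']; simp
      have hqT : q ∈ T ∩ T' := by rw [hpq']; simp
      rw [hpq', Finset.coe_insert, Finset.coe_singleton, image_insert_eq, image_singleton,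
        convexHull_pair, segment_eq_image'] at hface
      obtain ⟨s, -, rfl⟩ := hface
      rw [hedge T hT p (Finset.mem_inter.1 hpT).1 q (Finset.mem_inter.1 hqT).1,
        hedge T' hT' p (Finset.mem_inter.1 hpT).2 q (Finset.mem_inter.1 hqT).2]
  -- the global interpolation
  set ℓ : Plane → Plane := fun ξ =>
    if h : ∃ T ∈ 𝒯, ξ ∈ convexHull ℝ (y '' ↑T) then uT h.choose ξ else 0 with hℓ
  have hℓT : ∀ T ∈ 𝒯, ∀ ξ ∈ convexHull ℝ (y '' ↑T), ℓ ξ = uT T ξ := by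
    intro T hT ξ hξ
    have h : ∃ T ∈ 𝒯, ξ ∈ convexHull ℝ (y '' ↑T) := ⟨T, hT, hξ⟩
    simp only [hℓ, dif_pos h]
    exact huu _ h.choose_spec.1 T hT ξ h.choose_spec.2 hξ
  -- the segment and the cover pulled back to `[0, 1]`
  set d : Plane := y x' - y x with hd
  set γ : ℝ → Plane := fun u => y x + u • d with hγ
  have hγc : Continuous γ := continuous_const.add (continuous_id.smul continuous_const)
  have hγseg : ∀ u ∈ Icc (0 : ℝ) 1, γ u ∈ ball c r := fun u hu => by
    have : γ u ∈ segment ℝ (y x) (y x') := by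
      rw [segment_eq_image']
      exact mem_image_of_mem _ hu
    exact (convex_ball c r).segment_subset hx hx' this
  have hcovI : Icc (0 : ℝ) 1 ⊆ ⋃ T ∈ 𝒯, γ ⁻¹' convexHull ℝ (y '' ↑T) := fun u hu => by
    obtain ⟨T, hT, huT⟩ := hcov (γ u) (hγseg u hu)
    exact mem_iUnion₂.2 ⟨T, hT, huT⟩
  have hclosed : ∀ T ∈ 𝒯, IsClosed (γ ⁻¹' convexHull ℝ (y '' ↑T)) := fun T _ =>
    ((T.finite_toSet.image y).isCompact_convexHull ℝ).isClosed.preimage hγc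
  -- trivial case `x = x′`
  by_cases hxx : x = x'
  · subst hxx
    simp only [dist_self, sub_zero, mul_zero, zero_mul, Real.sqrt_zero, le_refl]
  have hdpos : 0 < dist (y x) (y x') := by have := hsep x x' hxx; linarith
  -- the deviation of each cover triangle
  set mT : Finset X → ℝ := fun T => Real.sqrt (sqDev y T) with hmT
  have hmT0 : ∀ T, 0 ≤ mT T := fun T => Real.sqrt_nonneg _
  have hmTle : ∀ T ∈ 𝒯, mT T ≤ 5 / 2 * α := fun T hT =>
    sqrt_sqDev_le hα.le (hmem𝒯.1 hT).1.card_eq_three (hTsr T hT)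
  have hKm : ∀ T ∈ 𝒯, K * mT T ≤ 1 / 4 := fun T hT => by
    have := mul_le_mul_of_nonneg_left (hmTle T hT) hK
    nlinarith
  -- Lipschitz bound on each piece: `L_T = (1 − K m_T)⁻¹ |y x − y x′|`
  set L : Finset X → ℝ := fun T => (1 - K * mT T)⁻¹ * dist (y x) (y x') with hL
  have hL0 : ∀ T ∈ 𝒯, 0 ≤ L T := fun T hT => by
    have : 0 < 1 - K * mT T := by linarith [hKm T hT]
    simp only [hL]; positivity
  have hlip : ∀ T ∈ 𝒯, ∀ u ∈ γ ⁻¹' convexHull ℝ (y '' ↑T), ∀ v ∈ γ ⁻¹' convexHull ℝ (y '' ↑T),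
      ‖ℓ (γ v) - ℓ (γ u)‖ ≤ L T * |v - u| := by
    intro T hT u hu v hv
    have h1K : 0 < 1 - K * mT T := by linarith [hKm T hT]
    rw [hℓT T hT _ hu, hℓT T hT _ hv]
    simp only [huT]
    rw [interp_sub]
    have hγvu : γ v - γ u = (v - u) • d := by
      simp only [hγ]
      rw [add_sub_add_left_eq_sub, sub_smul]
    rw [hγvu, map_smul, norm_smul, Real.norm_eq_abs]
    obtain ⟨ω', hΦ', haω, hbω, hcω⟩ := hloc (hTball T hT _ (hva T hT)) (hTball T hT _ (hvb T hT))
      (hTball T hT _ (hvc T hT)) (sab T hT) (sac T hT) (sbc T hT)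
    have hmle : Real.sqrt (sqDev y ({va T, vb T, vc T} : Finset X)) ≤ α₀ := by
      rw [← hTeq T hT]; exact (hmTle T hT).trans hαα₀
    have hG := triangle_inv_lipschitz_dev hBL hΦ' hα hα' (hab T hT) (hac T hT) (hbc T hT) hmle
      haω hbω hcω (sab T hT) (sac T hT) (sbc T hT) d
    rw [← hTeq T hT] at hG
    have hG' : ‖interpLin (yTri y (va T) (vb T) (vc T)) (ηTri Φ (va T) (vb T) (vc T)) d‖ ≤
        (1 - K * mT T)⁻¹ * ‖d‖ := by
      rw [← div_eq_inv_mul, le_div_iff₀' h1K]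
      exact hG
    have hdn : ‖d‖ = dist (y x) (y x') := by rw [hd, ← dist_eq_norm, dist_comm]
    rw [hdn] at hG'
    calc |v - u| * ‖interpLin (yTri y (va T) (vb T) (vc T)) (ηTri Φ (va T) (vb T) (vc T)) d‖
        ≤ |v - u| * L T := mul_le_mul_of_nonneg_left hG' (abs_nonneg _)
      _ = L T * |v - u| := mul_comm _ _
  -- diameter of each piece in parameter units: `(1 + α) / |y x − y x′|`
  set M : ℝ := (1 + α) / dist (y x) (y x') with hM
  have hM0 : 0 ≤ M := by rw [hM]; positivity
  have hdiam : ∀ T ∈ 𝒯, ∀ u ∈ γ ⁻¹' convexHull ℝ (y '' ↑T) ∩ Icc (0 : ℝ) 1,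
      ∀ v ∈ γ ⁻¹' convexHull ℝ (y '' ↑T) ∩ Icc (0 : ℝ) 1, |v - u| ≤ M := by
    intro T hT u hu v hv
    -- `|γ v − γ u| ≤ 1 + α` (two points of one unit triangle)
    have hTl : ∀ p ∈ T, ∀ q ∈ T, dist (y p) (y q) ≤ 1 + α := by
      intro p hp q hq
      by_cases hpq : p = q
      · rw [hpq, dist_self]; linarith
      · exact (hTsr T hT p hp q hq hpq).dist_le
    have hclose : ∀ (P : Plane), P ∈ convexHull ℝ (y '' ↑T) → ∀ q ∈ T, dist P (y q) ≤ 1 + α := by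
      intro P hP q hq
      have hsub : convexHull ℝ (y '' ↑T) ⊆ closedBall (y q) (1 + α) := by
        refine convexHull_min ?_ (convex_closedBall _ _)
        rintro _ ⟨p, hp, rfl⟩
        exact mem_closedBall.2 (hTl p (Finset.mem_coe.1 hp) q hq)
      exact mem_closedBall.1 (hsub hP)
    have hγd : dist (γ v) (γ u) ≤ 1 + α := by
      have hsub : convexHull ℝ (y '' ↑T) ⊆ closedBall (γ u) (1 + α) := by
        refine convexHull_min ?_ (convex_closedBall _ _)
        rintro _ ⟨p, hp, rfl⟩
        rw [mem_closedBall, dist_comm]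
        exact hclose (γ u) hu.1 p (Finset.mem_coe.1 hp)
      exact mem_closedBall.1 (hsub hv.1)
    have hγvu : dist (γ v) (γ u) = |v - u| * dist (y x) (y x') := by
      simp only [hγ]
      rw [dist_eq_norm, add_sub_add_left_eq_sub, ← sub_smul, norm_smul, Real.norm_eq_abs, hd,
        ← dist_eq_norm, dist_comm]
    rw [hM, le_div_iff₀ hdpos]
    rw [hγvu] at hγd
    exact hγd
  -- weighted telescoping
  obtain ⟨w, hw, hwsum, hchain⟩ := exists_weights_of_cover_Icc
    (fun T : Finset X => γ ⁻¹' convexHull ℝ (y '' ↑T)) (fun u => ℓ (γ u)) L M 𝒯 0 1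
    zero_le_one hM0 hclosed hL0 hlip hdiam hcovI
  -- the endpoints
  have hγ0 : γ 0 = y x := by simp [hγ]
  have hγ1 : γ 1 = y x' := by simp [hγ, hd]
  have hend : ∀ z : X, y z ∈ ball c r → ℓ (y z) = triPoint (Φ z) := by
    intro z hz
    obtain ⟨T, hT, hzT⟩ := hcov (y z) hz
    rw [hℓT T hT _ hzT]
    have hzT' : y z ∈ convexHull ℝ {y (va T), y (vb T), y (vc T)} := by
      rw [hTeq T hT, image_coe_triple] at hzT
      exact hzT
    have hmem := mem_of_mem_convexHull_triple hα hα' hsep (sab T hT) (sac T hT) (sbc T hT)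
      (hTgood T hT _ (hva T hT)) hzT'
    have hz' : z ∈ T := by
      rw [hTeq T hT]
      rcases hmem with h | h | h <;> simp [h]
    exact hvert T hT z hz'
  rw [hγ0, hγ1] at hchain
  rw [sub_zero] at hwsum
  -- `Σ L_T w_T ≤ d (1 + 2K Σ m_T w_T)` and Cauchy–Schwarz
  have hLle : ∀ T ∈ 𝒯, L T * w T ≤ dist (y x) (y x') * (w T + 2 * K * (mT T * w T)) := by
    intro T hT
    have h1K : 0 < 1 - K * mT T := by linarith [hKm T hT]
    have hinv : (1 - K * mT T)⁻¹ ≤ 1 + 2 * (K * mT T) := by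
      rw [inv_le_iff_one_le_mul₀ h1K]
      nlinarith [hKm T hT, mul_nonneg hK (hmT0 T)]
    have := mul_le_mul_of_nonneg_right hinv (mul_nonneg hdpos.le (hw T).1)
    simp only [hL]
    nlinarith [this]
  have hsum1 : ∑ T ∈ 𝒯, L T * w T ≤
      dist (y x) (y x') * (1 + 2 * K * ∑ T ∈ 𝒯, mT T * w T) := by
    calc ∑ T ∈ 𝒯, L T * w T ≤ ∑ T ∈ 𝒯, dist (y x) (y x') * (w T + 2 * K * (mT T * w T)) :=
          Finset.sum_le_sum hLle
      _ = dist (y x) (y x') * (1 + 2 * K * ∑ T ∈ 𝒯, mT T * w T) := by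
          rw [← Finset.mul_sum, Finset.sum_add_distrib, hwsum, ← Finset.mul_sum]
  have hcs := sq_sum_mul_le (δ := mT) hw hwsum
  have hS0 : 0 ≤ ∑ T ∈ 𝒯, mT T * w T :=
    Finset.sum_nonneg fun T _ => mul_nonneg (hmT0 T) (hw T).1
  have hsq : ∑ T ∈ 𝒯, mT T ^ 2 = ∑ T ∈ 𝒯, sqDev y T :=
    Finset.sum_congr rfl fun T _ => Real.sq_sqrt (sqDev_nonneg T)
  rw [hsq, mul_one] at hcs
  -- `Σ m w ≤ √(M Σ sqDev)` and `d √(M S) = √((1+α) d S)`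
  have hroot : ∑ T ∈ 𝒯, mT T * w T ≤ Real.sqrt (M * ∑ T ∈ 𝒯, sqDev y T) :=
    Real.le_sqrt_of_sq_le hcs
  have hdist : dist (triPoint (Φ x)) (triPoint (Φ x')) = ‖ℓ (y x') - ℓ (y x)‖ := by
    rw [hend x hx, hend x' hx', dist_comm, dist_eq_norm]
  rw [hdist]
  have hsub𝒰 : ∑ T ∈ 𝒯, sqDev y T ≤ ∑ T ∈ 𝒰, sqDev y T :=
    Finset.sum_le_sum_of_subset_of_nonneg (fun T hT => h𝒰 T (hmem𝒯.1 hT).1 (hmem𝒯.1 hT).2)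
      fun T _ _ => sqDev_nonneg T
  have hkey : dist (y x) (y x') * Real.sqrt (M * ∑ T ∈ 𝒯, sqDev y T) =
      Real.sqrt ((1 + α) * dist (y x) (y x') * ∑ T ∈ 𝒯, sqDev y T) := by
    rw [← Real.sqrt_sq hdpos.le, ← Real.sqrt_mul (sq_nonneg _), Real.sqrt_sq hdpos.le, hM]
    congr 1
    field_simp
  calc ‖ℓ (y x') - ℓ (y x)‖ - dist (y x) (y x')
      ≤ dist (y x) (y x') * (1 + 2 * K * ∑ T ∈ 𝒯, mT T * w T) - dist (y x) (y x') := by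
        linarith [hchain, hsum1]
    _ = 2 * K * (dist (y x) (y x') * ∑ T ∈ 𝒯, mT T * w T) := by ring
    _ ≤ 2 * K * (dist (y x) (y x') * Real.sqrt (M * ∑ T ∈ 𝒯, sqDev y T)) := by
        gcongr
    _ = 2 * K * Real.sqrt ((1 + α) * dist (y x) (y x') * ∑ T ∈ 𝒯, sqDev y T) := by rw [hkey]
    _ ≤ 2 * K * Real.sqrt ((1 + α) * dist (y x) (y x') * ∑ T ∈ 𝒰, sqDev y T) := by
        gcongr

end Upper

/-! ### The perfect lattice as a configuration: unit triangles of `A₂` -/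

section Lattice

variable {α : ℝ}

/-- `α ≤ 1/200 < √3 − 1`. [folklore] -/
private theorem lt_sqrt_three_sub_one (hα' : α ≤ 1 / 200) : α < √3 - 1 := by
  have h : (3 : ℝ) / 2 < √3 := by
    rw [show (3 : ℝ) / 2 = √(9 / 4) by
      rw [show (9 : ℝ) / 4 = (3 / 2) ^ 2 by norm_num, Real.sqrt_sq (by norm_num)]]
    exact Real.sqrt_lt_sqrt (by norm_num) (by norm_num)
  linarith

/-- The perfect lattice satisfies (13): distinct lattice points are `≥ 1 > 1 − α` apart.
[cite: Theil2006, §2.3 Remark 2.5 (preprint p. 7)] -/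
private theorem sep_triPoint (hα : 0 < α) :
    ∀ k k' : ℤ × ℤ, k ≠ k' → 1 - α < dist (triPoint k) (triPoint k') := by
  intro k k' hkk'
  rw [dist_triPoint]
  have h1 := one_le_norm_triPoint (sub_ne_zero.2 hkk')
  linarith

/-- Lattice points in a disc form a finite set. [folklore] -/
private theorem finite_lattice_dist_le (P : Plane) (M : ℝ) :
    {η : ℤ × ℤ | dist (triPoint η) P ≤ M}.Finite := by
  have h := (tendsto_norm_triPoint_cofinite.eventually_gt_atTop (M + ‖P‖))
  simp only [Filter.eventually_cofinite, not_lt] at h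
  refine h.subset fun η hη => ?_
  rw [mem_setOf_eq] at hη ⊢
  have := norm_le_norm_add_norm_sub' (triPoint η) P
  rw [← dist_eq_norm] at this
  linarith

/-- A point of the hull of a set all of whose points are within `m` of `P` is within `m` of `P`.
[folklore] -/
private theorem dist_le_of_mem_convexHull {s : Set Plane} {P f : Plane} {m : ℝ}
    (hs : ∀ Q ∈ s, dist Q P ≤ m) (hf : f ∈ convexHull ℝ s) : dist f P ≤ m := by
  have h : convexHull ℝ s ⊆ closedBall P m :=
    convexHull_min (fun Q hQ => mem_closedBall.2 (hs Q hQ)) (convex_closedBall P m)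
  exact mem_closedBall.1 (h hf)

/-- An explicit convex combination of three points lies in their convex hull. [folklore] -/
private theorem mem_convexHull_triple_of_eq {P Q R f : Plane} {a b c : ℝ} (ha : 0 ≤ a)
    (hb : 0 ≤ b) (hc : 0 ≤ c) (habc : a + b + c = 1) (hf : f = a • P + b • Q + c • R) :
    f ∈ convexHull ℝ ({P, Q, R} : Set Plane) := by
  have hconv : Convex ℝ (convexHull ℝ ({P, Q, R} : Set Plane)) := convex_convexHull ℝ _
  have hP : P ∈ convexHull ℝ ({P, Q, R} : Set Plane) := subset_convexHull ℝ _ (by simp)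
  have hQ : Q ∈ convexHull ℝ ({P, Q, R} : Set Plane) := subset_convexHull ℝ _ (by simp)
  have hR : R ∈ convexHull ℝ ({P, Q, R} : Set Plane) := subset_convexHull ℝ _ (by simp)
  have h := hconv.sum_mem (t := Finset.univ) (w := ![a, b, c]) (z := ![P, Q, R])
    (fun i _ => by fin_cases i <;> assumption) (by simp [Fin.sum_univ_three, habc])
    (fun i _ => by fin_cases i <;> assumption)
  rw [hf]
  simpa [Fin.sum_univ_three] using h

/-- `triPoint` on a three-element finset of labels. [folklore] -/
private theorem image_triPoint_triple (p q r : ℤ × ℤ) :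
    triPoint '' ↑({p, q, r} : Finset (ℤ × ℤ)) = {triPoint p, triPoint q, triPoint r} := by
  rw [Finset.coe_insert, Finset.coe_insert, Finset.coe_singleton, image_insert_eq,
    image_insert_eq, image_singleton]

/-- **The closed unit triangles of `A₂` cover the plane**: every point of `ℝ²` lies in
`conv(triPoint(T))` for a unit lattice triangle `T` (a short-range simplex of the perfect
lattice, `0 ≤ α < √3 − 1`): in lattice coordinates `(s, t)` with integer parts `(i, j)` and
fractional parts `(a, b)`, the triangle `{(i,j), (i+1,j), (i,j+1)}` if `a + b ≤ 1` and
`{(i+1,j+1), (i,j+1), (i+1,j)}` otherwise. [cite: Theil2006, §4.2 Lemma 4.6 («closed lattice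
triangles», preprint p. 19); our lemma] -/
private theorem exists_latticeTriangle (hα0 : 0 ≤ α) (hα3 : α < √3 - 1) (f : Plane) :
    ∃ T : Finset (ℤ × ℤ), IsEquilateralSimplex α triPoint 1 T ∧
      f ∈ convexHull ℝ (triPoint '' ↑T) := by
  classical
  have h3 : 0 < √3 := Real.sqrt_pos.2 (by norm_num)
  set t : ℝ := 2 / √3 * f 1 with ht
  set s : ℝ := f 0 - t / 2 with hs
  set i : ℤ := ⌊s⌋ with hi
  set j : ℤ := ⌊t⌋ with hj
  have ha0 : 0 ≤ s - i := sub_nonneg.2 (Int.floor_le s)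
  have ha1 : s - i < 1 := by have := Int.lt_floor_add_one s; linarith
  have hb0 : 0 ≤ t - j := sub_nonneg.2 (Int.floor_le t)
  have hb1 : t - j < 1 := by have := Int.lt_floor_add_one t; linarith
  have hf0 : f 0 = s + t / 2 := by rw [hs]; ring
  have hf1 : f 1 = √3 / 2 * t := by
    rw [ht]; field_simp
  -- short-range pairs of the lattice are the unit steps
  have hsr : ∀ p q : ℤ × ℤ, q - p ∈ unitShell → IsShortRange α triPoint p q := fun p q h =>
    (isShortRange_triPoint_iff hα0 hα3).2 h
  by_cases hab : s - i + (t - j) ≤ 1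
  · refine ⟨{(i, j), (i + 1, j), (i, j + 1)}, ?_, ?_⟩
    · rw [isEquilateralSimplex_one_iff]
      refine ⟨Finset.card_eq_three.2 ⟨(i, j), (i + 1, j), (i, j + 1), by simp, by simp,
        by simp [Prod.ext_iff], rfl⟩, ?_⟩
      intro p hp q hq hpq
      simp only [Finset.mem_insert, Finset.mem_singleton] at hp hq
      rcases hp with rfl | rfl | rfl <;> rcases hq with rfl | rfl | rfl <;>
        first
        | exact absurd rfl hpq
        | (apply hsr; simp [unitShell])
    · rw [image_triPoint_triple]
      refine mem_convexHull_triple_of_eq (a := 1 - (s - i) - (t - j)) (b := s - i) (c := t - j)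
        (by linarith) ha0 hb0 (by ring) ?_
      ext k
      fin_cases k
      · simp only [Fin.zero_eta, Fin.isValue, PiLp.add_apply, PiLp.smul_apply, smul_eq_mul,
          triPoint_apply_zero]
        push_cast
        rw [hf0]; ring
      · simp only [Fin.mk_one, Fin.isValue, PiLp.add_apply, PiLp.smul_apply, smul_eq_mul,
          triPoint_apply_one]
        push_cast
        rw [hf1]; ring
  · push Not at hab
    refine ⟨{(i + 1, j + 1), (i, j + 1), (i + 1, j)}, ?_, ?_⟩
    · rw [isEquilateralSimplex_one_iff]
      refine ⟨Finset.card_eq_three.2 ⟨(i + 1, j + 1), (i, j + 1), (i + 1, j), by simp,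
        by simp, by simp [Prod.ext_iff], rfl⟩, ?_⟩
      intro p hp q hq hpq
      simp only [Finset.mem_insert, Finset.mem_singleton] at hp hq
      rcases hp with rfl | rfl | rfl <;> rcases hq with rfl | rfl | rfl <;>
        first
        | exact absurd rfl hpq
        | (apply hsr; simp [unitShell])
    · rw [image_triPoint_triple]
      refine mem_convexHull_triple_of_eq (a := s - i + (t - j) - 1) (b := 1 - (s - i))
        (c := 1 - (t - j)) (by linarith) (by linarith) (by linarith) (by ring) ?_
      ext k
      fin_cases k
      · simp only [Fin.zero_eta, Fin.isValue, PiLp.add_apply, PiLp.smul_apply, smul_eq_mul,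
          triPoint_apply_zero]
        push_cast
        rw [hf0]; ring
      · simp only [Fin.mk_one, Fin.isValue, PiLp.add_apply, PiLp.smul_apply, smul_eq_mul,
          triPoint_apply_one]
        push_cast
        rw [hf1]; ring

/-- Short-range pairs of the perfect lattice are at distance exactly `1`.
[cite: Theil2006, §2.3 Remark 2.5 (preprint p. 7)] -/
private theorem dist_triPoint_eq_one_of_isShortRange (hα0 : 0 ≤ α) (hα3 : α < √3 - 1)
    {p q : ℤ × ℤ} (h : IsShortRange α triPoint p q) : dist (triPoint p) (triPoint q) = 1 := by
  rw [dist_comm, dist_triPoint]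
  exact norm_triPoint_of_mem_unitShell ((isShortRange_triPoint_iff hα0 hα3).1 h)

end Lattice

/-! ### The lower bound: telescoping along the label segment through realized unit triangles -/

section Lower

variable {X : Type*} {α : ℝ} {y : X → Plane} {ω : Set X} {Φ : X → ℤ × ℤ}

/-- A lattice triangle is *realized* by the imbedding `Φ` of the patch `ω` if each of its
vertices is the label of a non-defective particle of `ω` whose whole neighbourhood lies in `ω`
(so that Remark 2.5 applies at it). [cite: Theil2006, §2.3 Remark 2.5 (preprint p. 7); our
bookkeeping] -/
private def Realized (α : ℝ) (y : X → Plane) (ω : Set X) (Φ : X → ℤ × ℤ) (T : Finset (ℤ × ℤ)) :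
    Prop :=
  ∀ η ∈ T, ∃ p ∈ ω, Φ p = η ∧ p ∉ defectSet α y ∧ nbhdSet α y p ⊆ ω

/-- **`L²` form of (61), lower half, for every discrete imbedding** (realizability as a
hypothesis): if every unit lattice triangle meeting the label segment `[Φ(x), Φ(x′)]` is
realized by particles of `ω`, then
`|y(x) − y(x′)| − |Φ(x) − Φ(x′)| ≤ K √(|Φ(x) − Φ(x′)| Σ_S sqDev S)`, the sum over the unit
simplices of `y` inside `ω`. Proof: weighted telescoping of the affine interpolations
`Φ(v) ↦ y(v)` along the label segment through the closed unit triangles of `A₂` (an embedded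
complex), whose gradients are `≤ 1 + K m_S` by Lemma 4.2 with the realized simplex's own
deviation `m_S = √(sqDev S)`, the segment spending parameter length `≤ 1/|Φ(x) − Φ(x′)|` in each
triangle; then Cauchy–Schwarz. [cite: Theil2006, §4.1 Lemma 4.2 (50) and §4.2 Proposition 4.8
(2) (61) (preprint pp. 17, 21, 23); our `L²` variant of the telescoping] -/
private theorem dist_sub_le_aux {K α₀ : ℝ} (hBL : SimplexBiLipschitz K α₀) (hK : 0 ≤ K)
    (hΦ : IsDiscreteImbeddingOn α y ω Φ) (hα : 0 < α) (hα' : α ≤ 1 / 200)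
    (hαα₀ : 5 / 2 * α ≤ α₀) {x x' : X} (hx : x ∈ ω) (hx' : x' ∈ ω)
    (hreal : ∀ T : Finset (ℤ × ℤ), IsEquilateralSimplex α triPoint 1 T →
      (∃ f ∈ convexHull ℝ (triPoint '' ↑T), f ∈ segment ℝ (triPoint (Φ x)) (triPoint (Φ x'))) →
      Realized α y ω Φ T)
    (𝒰 : Finset (Finset X))
    (h𝒰 : ∀ S : Finset X, IsEquilateralSimplex α y 1 S → (∀ z ∈ S, z ∈ ω) → S ∈ 𝒰) :
    dist (y x) (y x') - dist (triPoint (Φ x)) (triPoint (Φ x')) ≤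
      K * Real.sqrt (dist (triPoint (Φ x)) (triPoint (Φ x')) * ∑ S ∈ 𝒰, sqDev y S) := by
  classical
  have hα1 : α < 1 := by linarith
  -- trivial case `x = x′`
  by_cases hxx : x = x'
  · subst hxx
    simp only [dist_self, sub_self, zero_mul, Real.sqrt_zero, mul_zero, le_refl]
  have hΦxx : Φ x ≠ Φ x' := fun h => hxx (hΦ.injOn hx hx' h)
  have hα3 : α < √3 - 1 := lt_sqrt_three_sub_one hα'
  have hsepΛ := sep_triPoint hα
  have hgoodΛ : ∀ v : ℤ × ℤ, v ∉ defectSet α (triPoint : ℤ × ℤ → Plane) := fun v hv => by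
    rw [defectSet_triPoint_eq_empty hα.le hα3] at hv
    exact hv
  set G₀ : Plane := triPoint (Φ x) with hG₀
  set G₁ : Plane := triPoint (Φ x') with hG₁
  set D : ℝ := dist G₀ G₁ with hD
  have hD1 : 1 ≤ D := by
    rw [hD, hG₀, hG₁, dist_triPoint]
    exact one_le_norm_triPoint (sub_ne_zero.2 hΦxx)
  have hDpos : 0 < D := by linarith
  -- a right inverse of the labelling on `ω`
  haveI : Nonempty X := ⟨x⟩
  set Ψ : ℤ × ℤ → X := fun g => if h : ∃ p ∈ ω, Φ p = g then h.choose else x with hΨ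
  have hΨspec : ∀ g : ℤ × ℤ, (∃ p ∈ ω, Φ p = g) → Ψ g ∈ ω ∧ Φ (Ψ g) = g := by
    intro g h
    simp only [hΨ, dif_pos h]
    exact h.choose_spec
  have hΨΦ : ∀ p ∈ ω, Ψ (Φ p) = p := by
    intro p hp
    have h : ∃ p' ∈ ω, Φ p' = Φ p := ⟨p, hp, rfl⟩
    exact hΦ.injOn (hΨspec _ h).1 hp (hΨspec _ h).2
  -- the finite family of realized unit triangles near the segment
  obtain ⟨Λ₀, hΛ₀⟩ := (finite_lattice_dist_le G₀ (D + 1)).exists_finset_coe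
  set 𝒞 : Finset (Finset (ℤ × ℤ)) :=
    Λ₀.powerset.filter (fun T => IsEquilateralSimplex α triPoint 1 T ∧ Realized α y ω Φ T)
    with h𝒞
  have hmem𝒞 : ∀ {T : Finset (ℤ × ℤ)}, T ∈ 𝒞 ↔ (∀ η ∈ T, dist (triPoint η) G₀ ≤ D + 1) ∧
      IsEquilateralSimplex α triPoint 1 T ∧ Realized α y ω Φ T := by
    intro T
    simp only [h𝒞, Finset.mem_filter, Finset.mem_powerset]
    constructor
    · rintro ⟨hsub, h1, h2⟩
      refine ⟨fun η hη => ?_, h1, h2⟩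
      have := hsub hη
      rw [← Finset.mem_coe, hΛ₀] at this
      exact this
    · rintro ⟨hsub, h1, h2⟩
      refine ⟨fun η hη => ?_, h1, h2⟩
      rw [← Finset.mem_coe, hΛ₀]
      exact hsub η hη
  have h𝒞sr : ∀ T ∈ 𝒞, ∀ p ∈ T, ∀ q ∈ T, p ≠ q → IsShortRange α triPoint p q := fun T hT =>
    (isEquilateralSimplex_one_iff.1 (hmem𝒞.1 hT).2.1).2
  -- particles realizing the vertices
  have hP : ∀ T ∈ 𝒞, ∀ η ∈ T,
      Ψ η ∈ ω ∧ Φ (Ψ η) = η ∧ Ψ η ∉ defectSet α y ∧ nbhdSet α y (Ψ η) ⊆ ω := by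
    intro T hT η hη
    obtain ⟨p, hp, hpη, hpd, hpN⟩ := (hmem𝒞.1 hT).2.2 η hη
    have h : ∃ p ∈ ω, Φ p = η := ⟨p, hp, hpη⟩
    have hΨη : Ψ η = p := by rw [← hpη, hΨΦ p hp]
    rw [hΨη]
    exact ⟨hp, hpη, hpd, hpN⟩
  have hPsr : ∀ T ∈ 𝒞, ∀ p ∈ T, ∀ q ∈ T, p ≠ q → IsShortRange α y (Ψ p) (Ψ q) := by
    intro T hT p hp q hq hpq
    have h1 : dist (triPoint (Φ (Ψ p))) (triPoint (Φ (Ψ q))) = 1 := by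
      rw [(hP T hT p hp).2.1, (hP T hT q hq).2.1]
      exact dist_triPoint_eq_one_of_isShortRange hα.le hα3 (h𝒞sr T hT p hp q hq hpq)
    exact hΦ.isShortRange_of_dist_eq_one hα1 (hP T hT p hp).2.2.1 (hP T hT p hp).2.2.2
      (hP T hT q hq).1 h1
  -- enumerations of the triangles
  have henum : ∀ T ∈ 𝒞, ∃ a b c' : ℤ × ℤ, a ≠ b ∧ a ≠ c' ∧ b ≠ c' ∧ T = {a, b, c'} := fun T hT =>
    Finset.card_eq_three.1 (hmem𝒞.1 hT).2.1.card_eq_three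
  choose! ea eb ec heab heac hebc hTeq using henum
  have hea : ∀ T ∈ 𝒞, ea T ∈ T := fun T hT => by
    have h : ea T ∈ ({ea T, eb T, ec T} : Finset (ℤ × ℤ)) := by simp
    rwa [← hTeq T hT] at h
  have heb : ∀ T ∈ 𝒞, eb T ∈ T := fun T hT => by
    have h : eb T ∈ ({ea T, eb T, ec T} : Finset (ℤ × ℤ)) := by simp
    rwa [← hTeq T hT] at h
  have hec : ∀ T ∈ 𝒞, ec T ∈ T := fun T hT => by
    have h : ec T ∈ ({ea T, eb T, ec T} : Finset (ℤ × ℤ)) := by simp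
    rwa [← hTeq T hT] at h
  -- the particles of a triangle and their short-range bonds
  have sab : ∀ T ∈ 𝒞, IsShortRange α y (Ψ (ea T)) (Ψ (eb T)) := fun T hT =>
    hPsr T hT _ (hea T hT) _ (heb T hT) (heab T hT)
  have sac : ∀ T ∈ 𝒞, IsShortRange α y (Ψ (ea T)) (Ψ (ec T)) := fun T hT =>
    hPsr T hT _ (hea T hT) _ (hec T hT) (heac T hT)
  have sbc : ∀ T ∈ 𝒞, IsShortRange α y (Ψ (eb T)) (Ψ (ec T)) := fun T hT =>
    hPsr T hT _ (heb T hT) _ (hec T hT) (hebc T hT)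
  -- the interpolations `Φ(v) ↦ y(v)`
  set vT : Finset (ℤ × ℤ) → Plane → Plane := fun T f =>
    interp (ηTri Φ (Ψ (ea T)) (Ψ (eb T)) (Ψ (ec T))) (yTri y (Ψ (ea T)) (Ψ (eb T)) (Ψ (ec T))) f
    with hvT
  have hDη : ∀ T ∈ 𝒞, det₂ (ηTri Φ (Ψ (ea T)) (Ψ (eb T)) (Ψ (ec T)) 1 -
      ηTri Φ (Ψ (ea T)) (Ψ (eb T)) (Ψ (ec T)) 0) (ηTri Φ (Ψ (ea T)) (Ψ (eb T)) (Ψ (ec T)) 2 -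
      ηTri Φ (Ψ (ea T)) (Ψ (eb T)) (Ψ (ec T)) 0) ≠ 0 := fun T hT =>
    det₂_ηTri_ne_zero hΦ hα1 (hP T hT _ (hea T hT)).1 (hP T hT _ (heb T hT)).1
      (hP T hT _ (hec T hT)).1 (sab T hT) (sac T hT) (sbc T hT)
  have hindex : ∀ T ∈ 𝒞, ∀ η ∈ T, ∃ i : Fin 3,
      triPoint η = ηTri Φ (Ψ (ea T)) (Ψ (eb T)) (Ψ (ec T)) i ∧
        y (Ψ η) = yTri y (Ψ (ea T)) (Ψ (eb T)) (Ψ (ec T)) i := by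
    intro T hT η hη
    have hη' := hη
    rw [hTeq T hT] at hη'
    simp only [Finset.mem_insert, Finset.mem_singleton] at hη'
    rcases hη' with rfl | rfl | rfl
    · exact ⟨0, by rw [ηTri_zero, (hP T hT _ hη).2.1], rfl⟩
    · exact ⟨1, by rw [ηTri_one, (hP T hT _ hη).2.1], rfl⟩
    · exact ⟨2, by rw [ηTri_two, (hP T hT _ hη).2.1], rfl⟩
  have hvert : ∀ T ∈ 𝒞, ∀ η ∈ T, vT T (triPoint η) = y (Ψ η) := by
    intro T hT η hη
    obtain ⟨i, hηi, hyi⟩ := hindex T hT η hη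
    simp only [hvT]
    rw [hηi, interp_vertex _ _ (hDη T hT), hyi]
  have hedge : ∀ T ∈ 𝒞, ∀ p ∈ T, ∀ q ∈ T, ∀ s : ℝ,
      vT T (triPoint p + s • (triPoint q - triPoint p)) = y (Ψ p) + s • (y (Ψ q) - y (Ψ p)) := by
    intro T hT p hp q hq s
    obtain ⟨i, hηi, hyi⟩ := hindex T hT p hp
    obtain ⟨j, hηj, hyj⟩ := hindex T hT q hq
    simp only [hvT]
    rw [hηi, hηj, interp_edge _ _ (hDη T hT), hyi, hyj]
  -- the interpolations agree on overlaps (the unit triangles of `A₂` form an embedded complex)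
  have hvv : ∀ T ∈ 𝒞, ∀ T' ∈ 𝒞, ∀ f : Plane, f ∈ convexHull ℝ (triPoint '' ↑T) →
      f ∈ convexHull ℝ (triPoint '' ↑T') → vT T f = vT T' f := by
    intro T hT T' hT' f hf hf'
    by_cases hTT' : T = T'
    · rw [hTT']
    have hface := convexHull_inter_convexHull_subset_face hα hα' hsepΛ (hmem𝒞.1 hT).2.1
      (hmem𝒞.1 hT').2.1 hTT' (fun v _ => hgoodΛ v) (fun v _ => hgoodΛ v) ⟨hf, hf'⟩
    have hlt : (T ∩ T').card < 3 := by
      rw [← (hmem𝒞.1 hT).2.1.card_eq_three]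
      refine Finset.card_lt_card (Finset.ssubset_iff_subset_ne.2 ⟨Finset.inter_subset_left, ?_⟩)
      intro heq
      apply hTT'
      have hsub : T ⊆ T' := by rw [← heq]; exact Finset.inter_subset_right
      exact Finset.eq_of_subset_of_card_le hsub
        (by rw [(hmem𝒞.1 hT).2.1.card_eq_three, (hmem𝒞.1 hT').2.1.card_eq_three])
    obtain h0 | h1 | h2 : (T ∩ T').card = 0 ∨ (T ∩ T').card = 1 ∨ (T ∩ T').card = 2 := by
      omega
    · rw [Finset.card_eq_zero] at h0
      rw [h0, Finset.coe_empty, image_empty, convexHull_empty] at hface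
      exact absurd hface (notMem_empty _)
    · obtain ⟨v, hv⟩ := Finset.card_eq_one.1 h1
      have hvT : v ∈ T ∩ T' := by rw [hv]; exact Finset.mem_singleton_self v
      rw [hv, Finset.coe_singleton, image_singleton, convexHull_singleton, mem_singleton_iff]
        at hface
      rw [hface, hvert T hT v (Finset.mem_inter.1 hvT).1,
        hvert T' hT' v (Finset.mem_inter.1 hvT).2]
    · obtain ⟨p, q, hpq, hpq'⟩ := Finset.card_eq_two.1 h2
      have hpT : p ∈ T ∩ T' := by rw [hpq']; simp
      have hqT : q ∈ T ∩ T' := by rw [hpq']; simp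
      rw [hpq', Finset.coe_insert, Finset.coe_singleton, image_insert_eq, image_singleton,
        convexHull_pair, segment_eq_image'] at hface
      obtain ⟨s, -, rfl⟩ := hface
      rw [hedge T hT p (Finset.mem_inter.1 hpT).1 q (Finset.mem_inter.1 hqT).1,
        hedge T' hT' p (Finset.mem_inter.1 hpT).2 q (Finset.mem_inter.1 hqT).2]
  -- the global interpolation on the label side
  set ℓ : Plane → Plane := fun f =>
    if h : ∃ T ∈ 𝒞, f ∈ convexHull ℝ (triPoint '' ↑T) then vT h.choose f else 0 with hℓ
  have hℓT : ∀ T ∈ 𝒞, ∀ f ∈ convexHull ℝ (triPoint '' ↑T), ℓ f = vT T f := by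
    intro T hT f hf
    have h : ∃ T ∈ 𝒞, f ∈ convexHull ℝ (triPoint '' ↑T) := ⟨T, hT, hf⟩
    simp only [hℓ, dif_pos h]
    exact hvv _ h.choose_spec.1 T hT f h.choose_spec.2 hf
  -- the label segment and the cover pulled back to `[0, 1]`
  set d : Plane := G₁ - G₀ with hd
  set γ : ℝ → Plane := fun u => G₀ + u • d with hγ
  have hγc : Continuous γ := continuous_const.add (continuous_id.smul continuous_const)
  have hdn : ‖d‖ = D := by rw [hd, hD, ← dist_eq_norm, dist_comm]
  have hγseg : ∀ u ∈ Icc (0 : ℝ) 1, γ u ∈ segment ℝ G₀ G₁ := fun u hu => by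
    rw [segment_eq_image']
    exact mem_image_of_mem _ hu
  have hγdist : ∀ u ∈ Icc (0 : ℝ) 1, dist (γ u) G₀ ≤ D := fun u hu => by
    simp only [hγ]
    rw [dist_eq_norm, add_sub_cancel_left, norm_smul, Real.norm_eq_abs, abs_of_nonneg hu.1, hdn]
    have hD0 : 0 ≤ D := dist_nonneg
    nlinarith [hu.2]
  have hcovI : Icc (0 : ℝ) 1 ⊆ ⋃ T ∈ 𝒞, γ ⁻¹' convexHull ℝ (triPoint '' ↑T) := fun u hu => by
    obtain ⟨T, hT1, huT⟩ := exists_latticeTriangle hα.le hα3 (γ u)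
    have hTr : Realized α y ω Φ T := hreal T hT1 ⟨γ u, huT, hγseg u hu⟩
    have hTsr := (isEquilateralSimplex_one_iff.1 hT1).2
    have hnear : ∀ η ∈ T, dist (triPoint η) G₀ ≤ D + 1 := by
      intro η hη
      have h1 : dist (γ u) (triPoint η) ≤ 1 := by
        refine dist_le_of_mem_convexHull (fun Q hQ => ?_) huT
        obtain ⟨η', hη', rfl⟩ := hQ
        by_cases hηη' : η' = η
        · rw [hηη', dist_self]; exact zero_le_one
        · exact (dist_triPoint_eq_one_of_isShortRange hα.le hα3 (hTsr η' hη' η hη hηη')).le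
      calc dist (triPoint η) G₀ ≤ dist (triPoint η) (γ u) + dist (γ u) G₀ := dist_triangle _ _ _
        _ ≤ 1 + D := by rw [dist_comm]; exact add_le_add h1 (hγdist u hu)
        _ = D + 1 := add_comm _ _
    exact mem_iUnion₂.2 ⟨T, hmem𝒞.2 ⟨hnear, hT1, hTr⟩, huT⟩
  have hclosed : ∀ T ∈ 𝒞, IsClosed (γ ⁻¹' convexHull ℝ (triPoint '' ↑T)) := fun T _ =>
    ((T.finite_toSet.image triPoint).isCompact_convexHull ℝ).isClosed.preimage hγc
  -- the particle triangles `S_T = Ψ(T)` are unit simplices of `y` inside `ω`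
  set S : Finset (ℤ × ℤ) → Finset X := fun T => {Ψ (ea T), Ψ (eb T), Ψ (ec T)} with hS
  have hΨne : ∀ T ∈ 𝒞, ∀ p ∈ T, ∀ q ∈ T, p ≠ q → Ψ p ≠ Ψ q := by
    intro T hT p hp q hq hpq h
    apply hpq
    rw [← (hP T hT p hp).2.1, ← (hP T hT q hq).2.1, h]
  have hSab : ∀ T ∈ 𝒞, Ψ (ea T) ≠ Ψ (eb T) := fun T hT =>
    hΨne T hT _ (hea T hT) _ (heb T hT) (heab T hT)
  have hSac : ∀ T ∈ 𝒞, Ψ (ea T) ≠ Ψ (ec T) := fun T hT =>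
    hΨne T hT _ (hea T hT) _ (hec T hT) (heac T hT)
  have hSbc : ∀ T ∈ 𝒞, Ψ (eb T) ≠ Ψ (ec T) := fun T hT =>
    hΨne T hT _ (heb T hT) _ (hec T hT) (hebc T hT)
  have hSmem : ∀ T ∈ 𝒞, ∀ p ∈ S T, ∃ η ∈ T, p = Ψ η := by
    intro T hT p hp
    simp only [hS, Finset.mem_insert, Finset.mem_singleton] at hp
    rcases hp with rfl | rfl | rfl
    · exact ⟨_, hea T hT, rfl⟩
    · exact ⟨_, heb T hT, rfl⟩
    · exact ⟨_, hec T hT, rfl⟩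
  have hScard : ∀ T ∈ 𝒞, (S T).card = 3 := fun T hT =>
    Finset.card_eq_three.2 ⟨_, _, _, hSab T hT, hSac T hT, hSbc T hT, rfl⟩
  have hSsr : ∀ T ∈ 𝒞, ∀ p ∈ S T, ∀ q ∈ S T, p ≠ q → IsShortRange α y p q := by
    intro T hT p hp q hq hpq
    obtain ⟨η, hη, rfl⟩ := hSmem T hT p hp
    obtain ⟨η', hη', rfl⟩ := hSmem T hT q hq
    exact hPsr T hT η hη η' hη' (fun h => hpq (by rw [h]))
  have hSsimp : ∀ T ∈ 𝒞, IsEquilateralSimplex α y 1 (S T) := fun T hT =>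
    isEquilateralSimplex_one_iff.2 ⟨hScard T hT, hSsr T hT⟩
  have hSω : ∀ T ∈ 𝒞, ∀ p ∈ S T, p ∈ ω := by
    intro T hT p hp
    obtain ⟨η, hη, rfl⟩ := hSmem T hT p hp
    exact (hP T hT η hη).1
  have hSΦ : ∀ T ∈ 𝒞, (S T).image Φ = T := by
    intro T hT
    simp only [hS, Finset.image_insert, Finset.image_singleton]
    rw [(hP T hT _ (hea T hT)).2.1, (hP T hT _ (heb T hT)).2.1, (hP T hT _ (hec T hT)).2.1,
      ← hTeq T hT]
  have hSinj : ∀ T ∈ 𝒞, ∀ T' ∈ 𝒞, S T = S T' → T = T' := by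
    intro T hT T' hT' h
    rw [← hSΦ T hT, ← hSΦ T' hT', h]
  -- the deviation of each realized triangle
  set mT : Finset (ℤ × ℤ) → ℝ := fun T => Real.sqrt (sqDev y (S T)) with hmT
  have hmT0 : ∀ T, 0 ≤ mT T := fun T => Real.sqrt_nonneg _
  have hmTle : ∀ T ∈ 𝒞, mT T ≤ 5 / 2 * α := fun T hT =>
    sqrt_sqDev_le hα.le (hScard T hT) (hSsr T hT)
  -- Lipschitz bound on each piece: `L_T = (1 + K m_T) D`
  set L : Finset (ℤ × ℤ) → ℝ := fun T => (1 + K * mT T) * D with hL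
  have hL0 : ∀ T ∈ 𝒞, 0 ≤ L T := fun T _ => by
    have := mul_nonneg hK (hmT0 T)
    simp only [hL]; positivity
  have hlip : ∀ T ∈ 𝒞, ∀ u ∈ γ ⁻¹' convexHull ℝ (triPoint '' ↑T),
      ∀ v ∈ γ ⁻¹' convexHull ℝ (triPoint '' ↑T), ‖ℓ (γ v) - ℓ (γ u)‖ ≤ L T * |v - u| := by
    intro T hT u hu v hv
    rw [hℓT T hT _ hu, hℓT T hT _ hv]
    simp only [hvT]
    rw [interp_sub]
    have hγvu : γ v - γ u = (v - u) • d := by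
      simp only [hγ]
      rw [add_sub_add_left_eq_sub, sub_smul]
    rw [hγvu, map_smul, norm_smul, Real.norm_eq_abs]
    have hmle : Real.sqrt (sqDev y ({Ψ (ea T), Ψ (eb T), Ψ (ec T)} : Finset X)) ≤ α₀ :=
      (hmTle T hT).trans hαα₀
    have hF := (triangle_bilipschitz_dev hBL hΦ hα1 (hSab T hT) (hSac T hT) (hSbc T hT) hmle
      (hP T hT _ (hea T hT)).1 (hP T hT _ (heb T hT)).1 (hP T hT _ (hec T hT)).1 (sab T hT)
      (sac T hT) (sbc T hT) d).2
    rw [hdn] at hF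
    calc |v - u| * ‖interpLin (ηTri Φ (Ψ (ea T)) (Ψ (eb T)) (Ψ (ec T)))
          (yTri y (Ψ (ea T)) (Ψ (eb T)) (Ψ (ec T))) d‖
        ≤ |v - u| * L T := mul_le_mul_of_nonneg_left hF (abs_nonneg _)
      _ = L T * |v - u| := mul_comm _ _
  -- diameter of each piece in parameter units: `1 / D` (a unit lattice triangle has diameter `1`)
  set M : ℝ := 1 / D with hM
  have hM0 : 0 ≤ M := by rw [hM]; positivity
  have hdiam : ∀ T ∈ 𝒞, ∀ u ∈ γ ⁻¹' convexHull ℝ (triPoint '' ↑T) ∩ Icc (0 : ℝ) 1,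
      ∀ v ∈ γ ⁻¹' convexHull ℝ (triPoint '' ↑T) ∩ Icc (0 : ℝ) 1, |v - u| ≤ M := by
    intro T hT u hu v hv
    have hTsr := h𝒞sr T hT
    have hTl : ∀ p ∈ T, ∀ q ∈ T, dist (triPoint p) (triPoint q) ≤ 1 := by
      intro p hp q hq
      by_cases hpq : p = q
      · rw [hpq, dist_self]; exact zero_le_one
      · exact (dist_triPoint_eq_one_of_isShortRange hα.le hα3 (hTsr p hp q hq hpq)).le
    have hclose : ∀ (P : Plane), P ∈ convexHull ℝ (triPoint '' ↑T) →
        ∀ q ∈ T, dist P (triPoint q) ≤ 1 := by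
      intro P hP q hq
      have hsub : convexHull ℝ (triPoint '' ↑T) ⊆ closedBall (triPoint q) 1 := by
        refine convexHull_min ?_ (convex_closedBall _ _)
        rintro _ ⟨p, hp, rfl⟩
        exact mem_closedBall.2 (hTl p (Finset.mem_coe.1 hp) q hq)
      exact mem_closedBall.1 (hsub hP)
    have hγd : dist (γ v) (γ u) ≤ 1 := by
      have hsub : convexHull ℝ (triPoint '' ↑T) ⊆ closedBall (γ u) 1 := by
        refine convexHull_min ?_ (convex_closedBall _ _)
        rintro _ ⟨p, hp, rfl⟩
        rw [mem_closedBall, dist_comm]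
        exact hclose (γ u) hu.1 p (Finset.mem_coe.1 hp)
      exact mem_closedBall.1 (hsub hv.1)
    have hγvu : dist (γ v) (γ u) = |v - u| * D := by
      simp only [hγ]
      rw [dist_eq_norm, add_sub_add_left_eq_sub, ← sub_smul, norm_smul, Real.norm_eq_abs, hdn]
    rw [hM, le_div_iff₀ hDpos]
    rw [hγvu] at hγd
    exact hγd
  -- weighted telescoping
  obtain ⟨w, hw, hwsum, hchain⟩ := exists_weights_of_cover_Icc
    (fun T : Finset (ℤ × ℤ) => γ ⁻¹' convexHull ℝ (triPoint '' ↑T)) (fun u => ℓ (γ u)) L M 𝒞 0 1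
    zero_le_one hM0 hclosed hL0 hlip hdiam hcovI
  -- the endpoints are labels, hence vertices of the triangles containing them
  have hγ0 : γ 0 = G₀ := by simp [hγ]
  have hγ1 : γ 1 = G₁ := by simp [hγ, hd]
  have hend : ∀ z : X, z ∈ ω → (∃ T ∈ 𝒞, triPoint (Φ z) ∈ convexHull ℝ (triPoint '' ↑T)) →
      ℓ (triPoint (Φ z)) = y z := by
    rintro z hz ⟨T, hT, hzT⟩
    rw [hℓT T hT _ hzT]
    have hzT' : triPoint (Φ z) ∈ convexHull ℝ {triPoint (ea T), triPoint (eb T), triPoint (ec T)} := by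
      rw [hTeq T hT, image_triPoint_triple] at hzT
      exact hzT
    have hsr := h𝒞sr T hT
    have hmem := mem_of_mem_convexHull_triple (y := (triPoint : ℤ × ℤ → Plane)) hα hα' hsepΛ
      (hsr _ (hea T hT) _ (heb T hT) (heab T hT)) (hsr _ (hea T hT) _ (hec T hT) (heac T hT))
      (hsr _ (heb T hT) _ (hec T hT) (hebc T hT)) (hgoodΛ _) hzT'
    have hz' : Φ z ∈ T := by
      rw [hTeq T hT]
      rcases hmem with h | h | h <;> simp [h]
    rw [hvert T hT (Φ z) hz', hΨΦ z hz]
  have h0cov : ∃ T ∈ 𝒞, triPoint (Φ x) ∈ convexHull ℝ (triPoint '' ↑T) := by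
    have := hcovI (left_mem_Icc.2 zero_le_one)
    rw [mem_iUnion₂] at this
    obtain ⟨T, hT, h⟩ := this
    exact ⟨T, hT, by rwa [mem_preimage, hγ0] at h⟩
  have h1cov : ∃ T ∈ 𝒞, triPoint (Φ x') ∈ convexHull ℝ (triPoint '' ↑T) := by
    have := hcovI (right_mem_Icc.2 zero_le_one)
    rw [mem_iUnion₂] at this
    obtain ⟨T, hT, h⟩ := this
    exact ⟨T, hT, by rwa [mem_preimage, hγ1] at h⟩
  rw [hγ0, hγ1, hG₀, hG₁, hend x hx h0cov, hend x' hx' h1cov] at hchain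
  rw [sub_zero] at hwsum
  -- `Σ L_T w_T = D (1 + K Σ m_T w_T)` and Cauchy–Schwarz
  have hsum1 : ∑ T ∈ 𝒞, L T * w T = D * (1 + K * ∑ T ∈ 𝒞, mT T * w T) := by
    have : ∀ T ∈ 𝒞, L T * w T = D * (w T + K * (mT T * w T)) := fun T _ => by
      simp only [hL]; ring
    rw [Finset.sum_congr rfl this, ← Finset.mul_sum, Finset.sum_add_distrib, hwsum,
      ← Finset.mul_sum]
  have hcs := sq_sum_mul_le (δ := mT) hw hwsum
  have hS0 : 0 ≤ ∑ T ∈ 𝒞, mT T * w T :=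
    Finset.sum_nonneg fun T _ => mul_nonneg (hmT0 T) (hw T).1
  have hsq : ∑ T ∈ 𝒞, mT T ^ 2 = ∑ T ∈ 𝒞, sqDev y (S T) :=
    Finset.sum_congr rfl fun T _ => Real.sq_sqrt (sqDev_nonneg (S T))
  rw [hsq, mul_one] at hcs
  have hroot : ∑ T ∈ 𝒞, mT T * w T ≤ Real.sqrt (M * ∑ T ∈ 𝒞, sqDev y (S T)) :=
    Real.le_sqrt_of_sq_le hcs
  -- reindex by the particle triangles and enlarge to `𝒰`
  have hsub𝒰 : ∑ T ∈ 𝒞, sqDev y (S T) ≤ ∑ S' ∈ 𝒰, sqDev y S' := by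
    rw [← Finset.sum_image (f := fun S' => sqDev y S') (hSinj)]
    refine Finset.sum_le_sum_of_subset_of_nonneg (fun S' hS' => ?_) fun S' _ _ => sqDev_nonneg S'
    obtain ⟨T, hT, rfl⟩ := Finset.mem_image.1 hS'
    exact h𝒰 (S T) (hSsimp T hT) (hSω T hT)
  have hkey : D * Real.sqrt (M * ∑ T ∈ 𝒞, sqDev y (S T)) =
      Real.sqrt (D * ∑ T ∈ 𝒞, sqDev y (S T)) := by
    rw [← Real.sqrt_sq hDpos.le, ← Real.sqrt_mul (sq_nonneg _), Real.sqrt_sq hDpos.le, hM]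
    congr 1
    field_simp
  have hdist : dist (y x) (y x') = ‖y x' - y x‖ := by rw [dist_comm, dist_eq_norm]
  rw [hdist]
  calc ‖y x' - y x‖ - D ≤ D * (1 + K * ∑ T ∈ 𝒞, mT T * w T) - D := by linarith [hchain, hsum1]
    _ = K * (D * ∑ T ∈ 𝒞, mT T * w T) := by ring
    _ ≤ K * (D * Real.sqrt (M * ∑ T ∈ 𝒞, sqDev y (S T))) := by gcongr
    _ = K * Real.sqrt (D * ∑ T ∈ 𝒞, sqDev y (S T)) := by rw [hkey]
    _ ≤ K * Real.sqrt (D * ∑ S' ∈ 𝒰, sqDev y S') := by gcongr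

end Lower

/-! ### Bond deviations of unit simplices versus short pairs -/

section Counting

variable {N : ℕ} {α : ℝ} {y : Fin N → Plane}

/-- `(√v)`-bounds square: `0 ≤ u ≤ c √v` gives `u² ≤ c² v`. [folklore] -/
private theorem sq_le_of_le_mul_sqrt {u c v : ℝ} (hu : 0 ≤ u) (hv : 0 ≤ v)
    (h : u ≤ c * Real.sqrt v) : u ^ 2 ≤ c ^ 2 * v := by
  have := pow_le_pow_left₀ hu h 2
  rwa [mul_pow, Real.sq_sqrt hv] at this

/-- **Unit-simplex deviations are controlled by the short pairs**: if every member of `𝒰` is a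
unit simplex with vertices in `W`, then `Σ_{S ∈ 𝒰} sqDev(S) ≤ 4 Σ_{p ∈ 𝒮(y), p ⊂ W} (|y p₁ − y p₂| − 1)²`
(each ordered bond is counted in at most two unit simplices, `simplexCount_le_two`, and twice as
an ordered pair). [cite: Theil2006, §2.3 (29) and the definition of `𝒮_j(y)` (preprint p. 9);
our bookkeeping] -/
private theorem sum_sqDev_le (hα : 0 < α) (hα' : α ≤ 1 / 20)
    (hsep : ∀ i j : Fin N, i ≠ j → 1 - α < dist (y i) (y j))
    (𝒰 : Finset (Finset (Fin N))) (W : Finset (Fin N))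
    (h𝒰 : ∀ S ∈ 𝒰, IsEquilateralSimplex α y 1 S ∧ ∀ a ∈ S, a ∈ W) :
    ∑ S ∈ 𝒰, sqDev y S ≤
      4 * ∑ p ∈ (shortRangePairs α y).filter (fun p => p.1 ∈ W ∧ p.2 ∈ W),
        (dist (y p.1) (y p.2) - 1) ^ 2 := by
  classical
  set g : Fin N × Fin N → ℝ := fun q => (dist (y q.1) (y q.2) - 1) ^ 2 with hg
  have hg0 : ∀ q, 0 ≤ g q := fun q => sq_nonneg _
  set P : Finset (Fin N × Fin N) :=
    (shortRangePairs α y).filter (fun p => p.1 ∈ W ∧ p.2 ∈ W) with hP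
  set Q : Finset (Fin N × Fin N) := 𝒰.biUnion Finset.offDiag with hQ
  have hmemQ : ∀ q ∈ Q, q.1 ≠ q.2 ∧ IsShortRange α y q.1 q.2 ∧ q.1 ∈ W ∧ q.2 ∈ W := by
    intro q hq
    obtain ⟨S, hS, hqS⟩ := Finset.mem_biUnion.1 hq
    obtain ⟨h1, h2, h12⟩ := Finset.mem_offDiag.1 hqS
    obtain ⟨hSe, hSW⟩ := h𝒰 S hS
    exact ⟨h12, (isEquilateralSimplex_one_iff.1 hSe).2 _ h1 _ h2 h12, hSW _ h1, hSW _ h2⟩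
  -- each `sqDev` as an indicator sum over `Q`
  have h1 : ∀ S ∈ 𝒰, sqDev y S = ∑ q ∈ Q, if q ∈ S.offDiag then g q else 0 := by
    intro S hS
    rw [← Finset.sum_filter]
    have hQS : Q.filter (fun q => q ∈ S.offDiag) = S.offDiag := by
      ext q
      simp only [Finset.mem_filter]
      exact ⟨fun h => h.2, fun h => ⟨Finset.mem_biUnion.2 ⟨S, hS, h⟩, h⟩⟩
    rw [hQS]
    rfl
  -- swap the sums
  have h2 : ∑ S ∈ 𝒰, sqDev y S =
      ∑ q ∈ Q, ((𝒰.filter fun S => q ∈ S.offDiag).card : ℝ) * g q := by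
    rw [Finset.sum_congr rfl h1, Finset.sum_comm]
    refine Finset.sum_congr rfl fun q _ => ?_
    rw [← Finset.sum_filter, Finset.sum_const, nsmul_eq_mul]
  -- multiplicity `≤ 2`
  have h3 : ∀ q ∈ Q, ((𝒰.filter fun S => q ∈ S.offDiag).card : ℝ) ≤ 2 := by
    intro q hq
    obtain ⟨-, hsr, -, -⟩ := hmemQ q hq
    have hle : (𝒰.filter fun S => q ∈ S.offDiag).card ≤ simplexCount α y q.1 q.2 := by
      unfold simplexCount
      refine Finset.card_le_card fun S hS => ?_
      rw [Finset.mem_filter] at hS ⊢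
      obtain ⟨hS𝒰, hqS⟩ := hS
      obtain ⟨hq1, hq2, -⟩ := Finset.mem_offDiag.1 hqS
      exact ⟨mem_unitSimplices_iff.2 (h𝒰 S hS𝒰).1, hq1, hq2⟩
    exact_mod_cast hle.trans (simplexCount_le_two hα hα' hsep hsr)
  -- `Q ⊆ P ∪ swap(P)`, the two halves carrying equal sums
  have hQsub : Q ⊆ P ∪ P.image Prod.swap := by
    intro q hq
    obtain ⟨h12, hsr, hW1, hW2⟩ := hmemQ q hq
    rw [Finset.mem_union]
    rcases lt_or_gt_of_ne h12 with hlt | hgt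
    · exact Or.inl (Finset.mem_filter.2 ⟨mem_shortRangePairs_iff.2 ⟨hlt, hsr⟩, hW1, hW2⟩)
    · exact Or.inr (Finset.mem_image.2 ⟨q.swap, Finset.mem_filter.2
        ⟨mem_shortRangePairs_iff.2 ⟨hgt, hsr.symm⟩, hW2, hW1⟩, Prod.swap_swap q⟩)
  have hdisj : Disjoint P (P.image Prod.swap) := by
    rw [Finset.disjoint_left]
    intro q hqP hqI
    obtain ⟨q', hq', hqq'⟩ := Finset.mem_image.1 hqI
    have ha := (mem_shortRangePairs_iff.1 (Finset.mem_filter.1 hqP).1).1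
    have hb := (mem_shortRangePairs_iff.1 (Finset.mem_filter.1 hq').1).1
    rw [← hqq'] at ha
    simp only [Prod.fst_swap, Prod.snd_swap] at ha
    exact lt_asymm ha hb
  have hswap : ∑ q ∈ P.image Prod.swap, g q = ∑ q ∈ P, g q := by
    rw [Finset.sum_image fun q _ q' _ h => Prod.swap_injective h]
    refine Finset.sum_congr rfl fun q _ => ?_
    simp only [hg, Prod.fst_swap, Prod.snd_swap, dist_comm]
  calc ∑ S ∈ 𝒰, sqDev y S
      = ∑ q ∈ Q, ((𝒰.filter fun S => q ∈ S.offDiag).card : ℝ) * g q := h2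
    _ ≤ ∑ q ∈ Q, 2 * g q :=
        Finset.sum_le_sum fun q hq => mul_le_mul_of_nonneg_right (h3 q hq) (hg0 q)
    _ ≤ ∑ q ∈ P ∪ P.image Prod.swap, 2 * g q :=
        Finset.sum_le_sum_of_subset_of_nonneg hQsub fun q _ _ => mul_nonneg zero_le_two (hg0 q)
    _ = 2 * ∑ q ∈ P, g q + 2 * ∑ q ∈ P, g q := by
        rw [Finset.sum_union hdisj, ← Finset.mul_sum, ← Finset.mul_sum, hswap]
    _ = 4 * ∑ p ∈ P, g p := by ring

end Counting

/-! ### The `L²` rigidity of a long simplex: the p. 11 display with factor `C λ` -/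

section Assembly

/-- **The `L²`-rigidity display of p. 11 with the factor `C λ` (in place of the print's
`C log λ`), from the existence of reference charts.** There are `C > 0` and `α₂ > 0` such that
for `0 < α < α₂`, every finite configuration with (13), every `λ ∈ Λ ∖ {1}` and every
`T ∈ 𝒯_λ(y)` (Definition 2.6, centred):
`½ Σ_{x ≠ x′ ∈ T} (|y(x) − y(x′)| − λ)² ≤ C λ Σ_{{x,x′} ∈ 𝒮(y), {x,x′} ⊂ ω_T} (|y(x) − y(x′)| − 1)²`
with `ω_T` the particles within `5λ` of the barycentre `z_T` — the shape of hypothesis (H52) of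
`Theil2006FromReferences` with `C₅₂ log λ` replaced by `C λ` (summable against `λ⁻⁷ · λ² m(λ)`
all the same). The print obtains `C log λ` from Proposition 4.3 (52) via the estimate of
Friesecke–James–Müller and the trace theorem; this weaker factor comes from the elementary
weighted telescoping of §4.2's proof of (61) along the two segments `[y(x), y(x′)]` (through the
unit simplices of `y`, (63)) and `[Φ(x), Φ(x′)]` (through the unit triangles of `A₂`, realized by
(62)), Lemma 4.2 with each simplex's own deviation, and Cauchy–Schwarz; the reference chart on
`B(z_T, 5λ − ½)` is hypothesis (H48′) (`Theil2006_existsRigidReference`) and its labels of `T`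
are `λ` apart by (60) (`discreteImbedding_unique_ball`) and Definition 2.6.
[cite: Theil2006, §2.4 display after (33) (preprint p. 11), Appendix Proposition 4.3 (52),
Lemma 4.2, Proposition 4.8 (60)–(63) (pp. 17–18, 21, 23); factor `λ` and proof ours] -/
theorem rigidityL2_of_existsRigid
    (h48 : ∃ α₀ K : ℝ, 0 < α₀ ∧ 0 ≤ K ∧ ∀ ⦃α : ℝ⦄, 0 < α → α < α₀ →
      ∀ {N : ℕ} (y : Fin N → Plane), (∀ i j : Fin N, i ≠ j → 1 - α < dist (y i) (y j)) →
      ∀ (c : Plane) (r R : ℝ), 2 ≤ r → 4 * r + 2 ≤ R → (∀ b ∈ defects α y, R ≤ dist (y b) c) →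
        ∃ Φ : Fin N → ℤ × ℤ, IsDiscreteImbeddingOn α y (y ⁻¹' ball c r) Φ ∧
          (∀ x x' : Fin N, y x ∈ ball c r → y x' ∈ ball c r → x ≠ x' →
            |dist (triPoint (Φ x)) (triPoint (Φ x')) / dist (y x) (y x') - 1| ≤ K * α)) :
    ∃ C : ℝ, 0 < C ∧ ∃ α₂ : ℝ, 0 < α₂ ∧ ∀ ⦃α : ℝ⦄, 0 < α → α < α₂ →
      ∀ {N : ℕ} (y : Fin N → Plane), (∀ i j : Fin N, i ≠ j → 1 - α < dist (y i) (y j)) →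
      ∀ lam : ↥(distSet \ {1}), ∃ ω : Finset (Fin N) → Finset (Fin N),
        (∀ T ∈ simplicesAt α y lam, ∀ a ∈ ω T, dist (y a) (simplexCentre y T) ≤ 5 * lam) ∧
        (∀ T ∈ simplicesAt α y lam,
          1 / 2 * ∑ p ∈ T.offDiag, (dist (y p.1) (y p.2) - lam) ^ 2 ≤
            C * lam * ∑ p ∈ (shortRangePairs α y).filter (fun p => p.1 ∈ ω T ∧ p.2 ∈ ω T),
                (dist (y p.1) (y p.2) - 1) ^ 2) := by
  classical
  obtain ⟨α₀, K₀, hα₀, -, h48⟩ := h48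
  obtain ⟨K, α₁, hK, hα₁, hBL⟩ := exists_simplexBiLipschitz
  refine ⟨96 * K ^ 2, by positivity, min α₀ (min (1 / 200) (min (2 * α₁ / 5) (1 / (10 * K)))),
    lt_min hα₀ (lt_min (by norm_num) (lt_min (by positivity) (by positivity))), ?_⟩
  intro α hα hαlt N y hsep lam
  have hαα₀ : α < α₀ := hαlt.trans_le (min_le_left _ _)
  have hα' : α ≤ 1 / 200 := (hαlt.trans_le ((min_le_right _ _).trans (min_le_left _ _))).le
  have hα51 : 5 / 2 * α ≤ α₁ := by
    have := (hαlt.trans_le ((min_le_right _ _).trans ((min_le_right _ _).trans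
      (min_le_left _ _)))).le
    linarith
  have hKα : K * α ≤ 1 / 10 := by
    have h := (hαlt.trans_le ((min_le_right _ _).trans ((min_le_right _ _).trans
      (min_le_right _ _)))).le
    rw [le_div_iff₀ (by positivity)] at h
    linarith
  have hα1 : α < 1 := by linarith
  have hαhalf : α ≤ 1 / 2 := by linarith
  have hsep' : ∀ x x' : Fin N, x ≠ x' → 1 - α < dist (y x) (y x') := fun x x' h => hsep x x' h
  -- `λ ≥ √3 ≥ 17/10`
  have hlam1 : (lam : ℝ) ≠ 1 := fun h => lam.2.2 h
  have h3lam : √3 ≤ (lam : ℝ) := sqrt_three_le_of_mem_distSet lam.2.1 hlam1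
  have h17 : (17 : ℝ) / 10 ≤ lam := (Real.le_sqrt_of_sq_le (by norm_num)).trans h3lam
  have hlam0 : (0 : ℝ) < lam := by linarith
  refine ⟨fun T => Finset.univ.filter (fun a => dist (y a) (simplexCentre y T) ≤ 5 * lam),
    fun T _ a ha => (Finset.mem_filter.1 ha).2, fun T hT => ?_⟩
  beta_reduce
  set W : Finset (Fin N) :=
    Finset.univ.filter (fun a => dist (y a) (simplexCentre y T) ≤ 5 * lam) with hWdef
  -- unpack `T ∈ 𝒯_λ(y)`
  obtain ⟨hEq, hcen⟩ := mem_simplicesAt.1 hT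
  have hEq' := hEq
  unfold IsEquilateralSimplex at hEq'
  obtain ⟨hcard, hcase⟩ := hEq'
  rcases hcase with ⟨h1, -⟩ | ⟨h1lam, hfar, ω, Φ, -, -, hΦ, hlab, -, hω3⟩
  · exact absurd h1 hlam1
  have hcenT : ∀ x ∈ T, dist (y x) (simplexCentre y T) ≤ lam := hcen h1lam
  set z : Plane := simplexCentre y T with hz
  -- `y` is injective, so the particles of `B(z, 3λ)` lie in `ω`
  have hyinj : ∀ a b : Fin N, y a = y b → a = b := by
    intro a b hab
    by_contra h
    have := hsep a b h
    rw [hab, dist_self] at this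
    linarith
  have hsubω : y ⁻¹' ball z (3 * lam) ⊆ ω := by
    intro b hb
    have hb' : y b ∈ closedBall z (3 * lam) ∩ range y :=
      ⟨ball_subset_closedBall hb, mem_range_self b⟩
    obtain ⟨p, hp, hpb⟩ := hω3 hb'
    rwa [← hyinj p b hpb]
  -- the reference chart `Ψ` on `B(z, 5λ − 1/2)` (H48′)
  have hdefects : ∀ b ∈ defects α y, 20 * (lam : ℝ) ≤ dist (y b) z := by
    intro b hb
    have hb' : b ∈ defectSet α y := by rw [← coe_defects]; exact Finset.mem_coe.2 hb
    exact (hfar b hb').le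
  obtain ⟨Ψ, hΨ, -⟩ := h48 hα hαα₀ y hsep z (5 * lam - 1 / 2) (20 * lam) (by linarith)
    (by linarith) hdefects
  -- (60): the `Ψ`-labels of the vertices of `T` are `λ` apart
  have hTball3 : ∀ t ∈ T, y t ∈ ball z (3 * lam) := fun t ht =>
    mem_ball.2 (by linarith [hcenT t ht])
  obtain ⟨k, hk⟩ := discreteImbedding_unique_ball hα hα' hsep (c := z) (r := 3 * lam)
    (by linarith) (fun b hb => by linarith [hfar b hb]) (hΦ.mono hsubω)
    (hΨ.mono (preimage_mono (ball_subset_ball (by linarith))))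
  have hlabΨ : ∀ t ∈ T, ∀ t' ∈ T, t ≠ t' →
      dist (triPoint (Ψ t)) (triPoint (Ψ t')) = lam := by
    intro t ht t' ht' htt'
    rw [dist_eq_norm, hk t t' (hTball3 t ht) (hTball3 t' ht'), LinearIsometryEquiv.norm_map,
      ← dist_eq_norm]
    exact hlab t ht t' ht' htt'
  have hTΩ : ∀ t ∈ T, t ∈ y ⁻¹' ball z (5 * lam - 1 / 2) := fun t ht =>
    show y t ∈ ball z _ from mem_ball.2 (by linarith [hcenT t ht])
  have hTr : ∀ t ∈ T, y t ∈ ball z (lam + 1 / 2) := fun t ht =>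
    mem_ball.2 (by linarith [hcenT t ht])
  -- the unit simplices of the chart disc
  set 𝒰 : Finset (Finset (Fin N)) := Finset.univ.filter
    (fun S => IsEquilateralSimplex α y 1 S ∧ ∀ a ∈ S, y a ∈ ball z (5 * lam - 1 / 2)) with h𝒰
  have hmem𝒰 : ∀ {S : Finset (Fin N)}, S ∈ 𝒰 ↔
      IsEquilateralSimplex α y 1 S ∧ ∀ a ∈ S, y a ∈ ball z (5 * lam - 1 / 2) := by
    intro S
    simp only [h𝒰, Finset.mem_filter, Finset.mem_univ, true_and]
  obtain ⟨SS, hSS⟩ : ∃ SS : ℝ, SS = ∑ S ∈ 𝒰, sqDev y S := ⟨_, rfl⟩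
  have hSS0 : 0 ≤ SS := by rw [hSS]; exact Finset.sum_nonneg fun S _ => sqDev_nonneg S
  -- (62): unit lattice triangles near `Ψ(t)`, `t ∈ T`, are realized in the chart disc
  have hreal1 : ∀ t ∈ T, ∀ η : ℤ × ℤ, dist (triPoint η) (triPoint (Ψ t)) ≤ lam / 2 + 1 →
      ∃ p ∈ y ⁻¹' ball z (5 * lam - 1 / 2), Ψ p = η ∧ p ∉ defectSet α y ∧
        nbhdSet α y p ⊆ y ⁻¹' ball z (5 * lam - 1 / 2) := by
    intro t ht η hη
    have hball : ∀ b, dist (y b) (y t) < lam + 2 + 1 / 16 →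
        b ∈ y ⁻¹' ball z (5 * lam - 1 / 2) := by
      intro b hb
      show y b ∈ ball z _
      rw [mem_ball]
      linarith [dist_triangle (y b) (y t) z, hcenT t ht]
    have hdef : ∀ b, dist (y b) (y t) < lam + 2 + 1 / 16 → b ∉ defectSet α y := by
      intro b hb hbd
      linarith [hfar b hbd, dist_triangle (y b) (y t) z, hcenT t ht]
    obtain ⟨p, hpd, hpη⟩ := hΨ.exists_eq_of_dist_lt_half' hα.le hαhalf hball hdef (g := η)
      (by linarith)
    have hpz : dist (y p) z ≤ 2 * lam + 2 := by
      linarith [dist_triangle (y p) (y t) z, hcenT t ht]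
    refine ⟨p, ?_, hpη, fun hpdef => ?_, fun b hb => ?_⟩
    · show y p ∈ ball z _
      rw [mem_ball]; linarith
    · linarith [hfar p hpdef]
    · rw [mem_nbhdSet_iff] at hb
      show y b ∈ ball z _
      rw [mem_ball]
      rcases hb with hb | hb
      · rw [hb]; linarith
      · have h1 : dist (y b) (y p) ≤ 1 + α := by rw [dist_comm]; exact hb.dist_le
        linarith [dist_triangle (y b) (y p) z]
  have hreal : ∀ t ∈ T, ∀ t' ∈ T, ∀ T₁ : Finset (ℤ × ℤ), IsEquilateralSimplex α triPoint 1 T₁ →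
      (∃ f ∈ convexHull ℝ (triPoint '' ↑T₁), f ∈ segment ℝ (triPoint (Ψ t)) (triPoint (Ψ t'))) →
      Realized α y (y ⁻¹' ball z (5 * lam - 1 / 2)) Ψ T₁ := by
    rintro t ht t' ht' T₁ hT₁ ⟨f, hfT, hfseg⟩
    have hT₁sr := (isEquilateralSimplex_one_iff.1 hT₁).2
    have hsum : dist (triPoint (Ψ t)) f + dist f (triPoint (Ψ t')) =
        dist (triPoint (Ψ t)) (triPoint (Ψ t')) := dist_add_dist_of_mem_segment hfseg
    have hle : dist (triPoint (Ψ t)) (triPoint (Ψ t')) ≤ lam := by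
      by_cases htt : t = t'
      · rw [htt, dist_self]; exact hlam0.le
      · exact (hlabΨ t ht t' ht' htt).le
    unfold Realized
    intro η hη
    have hηf : dist (triPoint η) f ≤ 1 := by
      rw [dist_comm]
      refine dist_le_of_mem_convexHull (fun Q hQ => ?_) hfT
      obtain ⟨η', hη', rfl⟩ := hQ
      by_cases hηη' : η' = η
      · rw [hηη', dist_self]; exact zero_le_one
      · have hα3 : α < √3 - 1 := lt_sqrt_three_sub_one hα'
        exact (dist_triPoint_eq_one_of_isShortRange hα.le hα3 (hT₁sr η' hη' η hη hηη')).le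
    have hclose : dist f (triPoint (Ψ t)) ≤ lam / 2 ∨ dist f (triPoint (Ψ t')) ≤ lam / 2 := by
      rcases le_or_gt (dist f (triPoint (Ψ t))) (lam / 2) with h | h
      · exact Or.inl h
      · right
        rw [dist_comm] at hsum
        linarith
    rcases hclose with h | h
    · exact hreal1 t ht η (by linarith [dist_triangle (triPoint η) f (triPoint (Ψ t))])
    · exact hreal1 t' ht' η (by linarith [dist_triangle (triPoint η) f (triPoint (Ψ t'))])
  -- local charts for the y-side telescoping: the chart disc itself
  have hloc : ∀ ⦃a b c' : Fin N⦄, y a ∈ ball z (lam + 5 / 2) → y b ∈ ball z (lam + 5 / 2) →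
      y c' ∈ ball z (lam + 5 / 2) → IsShortRange α y a b → IsShortRange α y a c' →
      IsShortRange α y b c' →
      ∃ ω' : Set (Fin N), IsDiscreteImbeddingOn α y ω' Ψ ∧ a ∈ ω' ∧ b ∈ ω' ∧ c' ∈ ω' := by
    intro a b c' ha hb hc _ _ _
    have hsub : ball z (lam + 5 / 2) ⊆ ball z (5 * lam - 1 / 2) := ball_subset_ball (by linarith)
    exact ⟨_, hΨ, hsub ha, hsub hb, hsub hc⟩
  have h𝒰₁ : ∀ S : Finset (Fin N), IsEquilateralSimplex α y 1 S →
      (∀ a ∈ S, a ∈ y ⁻¹' ball z (5 * lam - 1 / 2)) → S ∈ 𝒰 := fun S hS hSa =>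
    hmem𝒰.2 ⟨hS, hSa⟩
  have h𝒰₂ : ∀ S : Finset (Fin N), IsEquilateralSimplex α y 1 S →
      (∀ a ∈ S, y a ∈ ball z (lam + 5 / 2)) → S ∈ 𝒰 := fun S hS hSa =>
    hmem𝒰.2 ⟨hS, fun a ha => ball_subset_ball (by linarith) (hSa a ha)⟩
  have hdefR : ∀ b ∈ defectSet α y, lam + 5 / 2 ≤ dist (y b) z := fun b hb => by
    linarith [hfar b hb]
  -- per ordered pair of vertices
  have hpair : ∀ q ∈ T.offDiag, (dist (y q.1) (y q.2) - lam) ^ 2 ≤ 8 * K ^ 2 * lam * SS := by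
    intro q hq
    obtain ⟨h1, h2, h12⟩ := Finset.mem_offDiag.1 hq
    have hlo := dist_sub_le_aux hBL hK.le hΨ hα hα' hα51 (hTΩ _ h1) (hTΩ _ h2) (hreal _ h1 _ h2)
      𝒰 h𝒰₁
    have hup := sub_dist_le_aux hBL hK.le hα hα' hα51 hKα hsep' (c := z) (r := lam + 1 / 2)
      (R := lam + 5 / 2) (by linarith) hdefR hloc (hTr _ h1) (hTr _ h2) 𝒰 h𝒰₂
    rw [hlabΨ _ h1 _ h2 h12, ← hSS] at hlo hup
    have hd0 : 0 ≤ dist (y q.1) (y q.2) := dist_nonneg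
    have hK2 : 0 ≤ K ^ 2 * (lam * SS) := mul_nonneg (sq_nonneg K) (mul_nonneg hlam0.le hSS0)
    rcases le_or_gt (lam : ℝ) (dist (y q.1) (y q.2)) with hle | hlt
    · have := sq_le_of_le_mul_sqrt (by linarith) (mul_nonneg hlam0.le hSS0) hlo
      nlinarith
    · have := sq_le_of_le_mul_sqrt (by linarith)
        (mul_nonneg (mul_nonneg (by linarith) hd0) hSS0) hup
      have hdd : (1 + α) * dist (y q.1) (y q.2) * SS ≤ 2 * lam * SS := by
        apply mul_le_mul_of_nonneg_right _ hSS0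
        nlinarith
      have h4 : (lam - dist (y q.1) (y q.2)) ^ 2 ≤ (2 * K) ^ 2 * (2 * lam * SS) :=
        this.trans (mul_le_mul_of_nonneg_left hdd (sq_nonneg _))
      rw [show (dist (y q.1) (y q.2) - lam) ^ 2 = (lam - dist (y q.1) (y q.2)) ^ 2 by ring]
      linarith
  -- sum over the six ordered pairs
  have hcardoff : (T.offDiag.card : ℝ) = 6 := by
    rw [Finset.offDiag_card, hcard]; norm_num
  have hsum6 : ∑ q ∈ T.offDiag, (dist (y q.1) (y q.2) - lam) ^ 2 ≤
      6 * (8 * K ^ 2 * lam * SS) := by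
    calc ∑ q ∈ T.offDiag, (dist (y q.1) (y q.2) - lam) ^ 2
        ≤ ∑ _q ∈ T.offDiag, 8 * K ^ 2 * lam * SS := Finset.sum_le_sum hpair
      _ = 6 * (8 * K ^ 2 * lam * SS) := by rw [Finset.sum_const, nsmul_eq_mul, hcardoff]
  -- unit-simplex deviations versus short pairs of `ω_T`
  have hW : ∀ S ∈ 𝒰, IsEquilateralSimplex α y 1 S ∧ ∀ a ∈ S, a ∈ W := by
    intro S hS
    obtain ⟨hSe, hSa⟩ := hmem𝒰.1 hS
    refine ⟨hSe, fun a ha => ?_⟩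
    rw [hWdef]
    refine Finset.mem_filter.2 ⟨Finset.mem_univ _, ?_⟩
    have := mem_ball.1 (hSa a ha)
    linarith
  have hcount := sum_sqDev_le hα (by linarith) hsep 𝒰 W hW
  rw [← hSS] at hcount
  have hfin := mul_le_mul_of_nonneg_left hcount
    (show (0 : ℝ) ≤ 24 * K ^ 2 * lam by positivity)
  linarith

end Assembly
end Theil2006

end Literature.MathematicalPhysics.StatisticalMechanics
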